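import Mathlib
import Literature.NumberTheory.Sieve.ShnirelmanGoldbachThree
import HarnessLib

/-!
# An explicit Shnirel'man–Goldbach theorem, continued (VI): `39` primes under Rosser–Schoenfeld (3.3) (`41` → `39`; unconditional `45` unchanged)

Topic `Literature/NumberTheory/Sieve`; namespace `Literature.NumberTheory.Sieve.ShnirelmanGoldbachExplicit` (continued —
this is §25 of the story of `ShnirelmanGoldbachExplicit.lean` (§1–§12), `ShnirelmanGoldbachFlatten.lean` (§13–§15),
`ShnirelmanGoldbachBonferroni.lean` (§16–§19), `ShnirelmanGoldbachShifts.lean` (§20–§21), `ShnirelmanGoldbachCells.lean` (§22)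
and `ShnirelmanGoldbachThree.lean` (§23–§24), kept in its own module for the gate's size cap).  Cell `parity-ideate` seat p5
g19 (final round), ROUND-41 «GAP-16» (`round41/SchnirelmannGap.lean` sha16 925489b40af1ab3a, its §8, lines 7014–8145, with the
needed §1/§3/§4.1/§5.1/§6.1 helper copies), landed with statements and proofs verbatim (helpers `private`, verbatim `private`
copies of the earlier modules' private helpers, as in the source).  No named facts, no definitions, no instances, no notation.

## References
* [Nathanson1996] M. B. Nathanson, *Additive Number Theory: The Classical Bases*, GTM 164 (1996), §7.3, Theorems 7.8–7.9.
* [BatemanDiamond2004] P. T. Bateman, H. G. Diamond, *Analytic Number Theory: An Introductory Course* (2004), §13.4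
  (13.13)–(13.14), Lemma 13.11, Theorem 13.8.
* [RosserSchoenfeld1962] J. B. Rosser, L. Schoenfeld, *Approximate formulas for some functions of prime numbers*,
  Illinois J. Math. 6 (1962), Theorem 2, eq. (3.3) (the conditional column's input).

## Content

* §25 (ROUND-41 «GAP-16»): ONE input varied relative to §23 — the threshold gap of the `J = 400` Hölder count,
  `Λs + 12 ≤ Λ₀` ↦ `Λs + 16 ≤ Λ₀`, so the discard `0.0057` becomes `0.00005` (`goldbach_even_count_ge_holder400g`, `F` up by
  `0.58 %`); the enlarged-cell pair sieve re-instantiated from `e^38` (`explicit_of_largeSieve_kappa2_c38`,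
  `pairCount_le_of_numeric2_c38`, `pairCount_le_1745`), the 68-cell pair sieves `13.06` from `e^109` and `12.19` from `e^190`
  (`pairCount_le_of_numeric3_c`, `pairCount_le_1306`, `pairCount_le_1219`), the RS five-regime glue from `L₁ ≥ 38` with `h ≥ 19`
  (`half_count_ge_allN_three_RS38`), the count `11.78` from `e^294` (`goldbachCount_le_1178`); at `(Λs, Λ₀) = (294, 310)`:
  `x/38` even Goldbach numbers under (3.3) (`goldbach_even_count_ge_of_RS_38`), `σ(B) ≥ 1/19` and
  **`schnirelmann_goldbach_of_RS_le_39`** (Mann: `2·19 + 1`): under Rosser–Schoenfeld (3.3) every `N ≥ 2` is a sum of at most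
  `39` primes.  (The unconditional column stays at `45`, §24.)

Table of the series (K unconditional / under Rosser–Schoenfeld (3.3)): … → §22 47/43 → §23–§24 45/41 → §25 45/39.
Print calibration (NOT formalised, not used): Klimov 1975 (`55`), Vaughan 1977 (`27`), Deshouillers 1977 (`26`),
Riesel–Vaughan 1983 (`19`), Ramaré 1995 (even `n`: `≤ 6` primes), Helfgott 2013 (`K ≤ 4`).
-/

namespace Literature.NumberTheory.Sieve.ShnirelmanGoldbachExplicit

open Finset Real
open scoped Classical Pointwise
open Literature.NumberTheory.Sieve Literature.Combinatorics.Additive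
open Literature.NumberTheory.Sieve.GoldbachSieveEight (ft Qsum sum_ft_le_Qsum)
open Literature.NumberTheory.Sieve.TwoResidueSelbergExplicit (kappaSet2 TlowK2 sum_ft_ge_kappa2 Qsum_ge_kappa2
  kappaSet3 TlowK3 sum_ft_ge_kappa3 Qsum_ge_kappa3)
open Literature.NumberTheory.Sieve.GoldbachLinnik (oddSingularFactor oddSingularFactor_nonneg)
open Literature.NumberTheory.Sieve.RomanoffExplicit (PrimeCountingLowerMul primeCountingLowerMul_09212
  primeCounting_ge_div45)

/-! ### Private copies (verbatim) of the helpers of §1–§24 used below -/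

/-- `r(N) ≤ N + 1`. [folklore] -/
private theorem goldbachCount_le_succ (N : ℕ) : SingularSeries.goldbachCount N ≤ N + 1 := by
  unfold SingularSeries.goldbachCount
  exact (card_filter_le _ _).trans (by rw [Finset.Nat.card_antidiagonal])

/-- For odd `N`, `r(N) ≤ 2` (one of `p, q` is even, hence `= 2`). [folklore] -/
private theorem goldbachCount_le_two_of_odd {N : ℕ} (hN : Odd N) : SingularSeries.goldbachCount N ≤ 2 := by
  unfold SingularSeries.goldbachCount
  calc #{pq ∈ antidiagonal N | pq.1.Prime ∧ pq.2.Prime}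
      ≤ #({(2, N - 2), (N - 2, 2)} : Finset (ℕ × ℕ)) := by
        refine card_le_card fun pq hpq => ?_
        rw [mem_filter, Finset.HasAntidiagonal.mem_antidiagonal] at hpq
        obtain ⟨hsum, hp, hq⟩ := hpq
        rw [mem_insert, mem_singleton]
        rcases Nat.even_or_odd pq.1 with h1 | h1
        · have h2 : pq.1 = 2 := (Nat.Prime.even_iff hp).mp h1
          left
          exact Prod.ext h2 (by simp only; omega)
        · have h2 : Even pq.2 := by
            rw [← hsum] at hN
            exact (Nat.odd_add.mp hN).mp h1
          have h3 : pq.2 = 2 := (Nat.Prime.even_iff hq).mp h2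
          right
          exact Prod.ext (by simp only; omega) h3
    _ ≤ 2 := card_le_two

/-- `t/log²t` is increasing on `[e², ∞)`. [folklore] -/
private theorem div_log_sq_mono {a b : ℝ} (ha : Real.exp 2 ≤ a) (hab : a ≤ b) :
    a / Real.log a ^ 2 ≤ b / Real.log b ^ 2 := by
  have ha0 : 0 < a := lt_of_lt_of_le (Real.exp_pos 2) ha
  have hb0 : 0 < b := lt_of_lt_of_le ha0 hab
  have hu2 : 2 ≤ Real.log a := by
    have := Real.log_le_log (Real.exp_pos 2) ha
    rwa [Real.log_exp] at this
  have huv : Real.log a ≤ Real.log b := Real.log_le_log ha0 hab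
  have hexp : b = a * Real.exp (Real.log b - Real.log a) := by
    rw [Real.exp_sub, Real.exp_log hb0, Real.exp_log ha0]
    field_simp
  set u := Real.log a with hu_def
  set v := Real.log b with hv_def
  set d := v - u with hd
  have hd0 : 0 ≤ d := by rw [hd]; linarith
  have hq := Real.quadratic_le_exp_of_nonneg hd0
  have hu0 : (0 : ℝ) < u := by linarith
  have hv0 : (0 : ℝ) < v := by linarith
  rw [div_le_div_iff₀ (pow_pos hu0 2) (pow_pos hv0 2)]
  have hv : v = u + d := by rw [hd]; ring
  rw [hv, hexp]
  have hin : (u + d) ^ 2 ≤ (1 + d + d ^ 2 / 2) * u ^ 2 := by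
    nlinarith [mul_nonneg hd0 (by nlinarith : (0 : ℝ) ≤ u ^ 2 - 2 * u),
      mul_nonneg (sq_nonneg d) (by nlinarith : (0 : ℝ) ≤ u ^ 2 / 2 - 1)]
  calc a * (u + d) ^ 2 ≤ a * ((1 + d + d ^ 2 / 2) * u ^ 2) := mul_le_mul_of_nonneg_left hin ha0.le
    _ ≤ a * (Real.exp d * u ^ 2) :=
        mul_le_mul_of_nonneg_left (mul_le_mul_of_nonneg_right hq (sq_nonneg u)) ha0.le
    _ = a * Real.exp d * u ^ 2 := by ring

/-- `log⁴x ≤ 4096·√x` for `x ≥ 1` (`log x = 8 log x^{1/8} ≤ 8 x^{1/8}`). [folklore] -/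
private theorem log_pow_four_le_sqrt {x : ℝ} (hx : 1 ≤ x) : Real.log x ^ 4 ≤ 4096 * Real.sqrt x := by
  set t := Real.sqrt (Real.sqrt (Real.sqrt x)) with ht
  have hx0 : 0 ≤ x := by linarith
  have ht1 : 1 ≤ t := Real.one_le_sqrt.mpr (Real.one_le_sqrt.mpr (Real.one_le_sqrt.mpr hx))
  have ht0 : 0 < t := by linarith
  have ht2 : t ^ 2 = Real.sqrt (Real.sqrt x) := by rw [ht, Real.sq_sqrt (Real.sqrt_nonneg _)]
  have ht4 : t ^ 4 = Real.sqrt x := by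
    rw [show t ^ 4 = (t ^ 2) ^ 2 by ring, ht2, Real.sq_sqrt (Real.sqrt_nonneg _)]
  have ht8 : t ^ 8 = x := by
    rw [show t ^ 8 = (t ^ 4) ^ 2 by ring, ht4, Real.sq_sqrt hx0]
  have hlog : Real.log x = 8 * Real.log t := by
    rw [← ht8, Real.log_pow]; norm_num
  have hlt : Real.log t ≤ t := by linarith [Real.log_le_sub_one_of_pos ht0]
  have hl0 : 0 ≤ Real.log t := Real.log_nonneg ht1
  rw [hlog, ← ht4, show (8 * Real.log t) ^ 4 = 4096 * Real.log t ^ 4 by ring]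
  exact mul_le_mul_of_nonneg_left (pow_le_pow_left₀ hl0 hlt 4) (by norm_num)

/-- **Odd `N` are negligible in the first moment**: `Σ_{odd N ≤ x} r(N) ≤ 2(x + 1)`. [folklore] -/
private theorem sum_goldbachCount_odd_le (x : ℕ) :
    ∑ N ∈ (range (x + 1)).filter (fun N => ¬Even N), (SingularSeries.goldbachCount N : ℝ) ≤ 2 * ((x : ℝ) + 1) := by
  calc ∑ N ∈ (range (x + 1)).filter (fun N => ¬Even N), (SingularSeries.goldbachCount N : ℝ)
      ≤ ∑ N ∈ (range (x + 1)).filter (fun N => ¬Even N), (2 : ℝ) := sum_le_sum fun N hN => by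
        rw [mem_filter] at hN
        exact_mod_cast goldbachCount_le_two_of_odd (Nat.not_even_iff_odd.mp hN.2)
    _ = #((range (x + 1)).filter (fun N => ¬Even N)) * 2 := by rw [sum_const, nsmul_eq_mul]
    _ ≤ ((x : ℝ) + 1) * 2 := by
        apply mul_le_mul_of_nonneg_right _ (by norm_num)
        have : #((range (x + 1)).filter (fun N => ¬Even N)) ≤ x + 1 :=
          (card_filter_le _ _).trans (by rw [card_range])
        exact_mod_cast this
    _ = 2 * ((x : ℝ) + 1) := by ring

/-- The halving map: `#{even N ∈ (0, 2y] : N = p + q} ≤ #{b ∈ (0, y] : b ∈ B}`, `B = {0, 1} ∪ {m : 2m = p + q}`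
(`N ↦ N/2`). [folklore] -/
private theorem even_goldbach_card_le_half (y : ℕ) :
    #{N ∈ Ioc 0 (2 * y) | Even N ∧ ∃ p q : ℕ, p.Prime ∧ q.Prime ∧ p + q = N}
      ≤ #{b ∈ Ioc 0 y | b ∈ (({0, 1} : Set ℕ) ∪ {m | ∃ p q : ℕ, p.Prime ∧ q.Prime ∧ p + q = 2 * m})} := by
  refine card_le_card_of_injOn (fun N => N / 2) ?_ ?_
  · intro N hN
    rw [mem_coe, mem_filter, mem_Ioc] at hN
    obtain ⟨⟨hN0, hNy⟩, ⟨k, hk⟩, p, q, hp, hq, hpq⟩ := hN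
    rw [mem_coe, mem_filter, mem_Ioc]
    dsimp only
    exact ⟨⟨by omega, by omega⟩, Or.inr ⟨p, q, hp, hq, by omega⟩⟩
  · intro N hN N' hN' h
    rw [mem_coe, mem_filter] at hN hN'
    obtain ⟨k, hk⟩ := hN.2.1
    obtain ⟨k', hk'⟩ := hN'.2.1
    simp only at h
    omega

/-- `σ(S) ≥ 1/K` from `S(N) ≥ N/K` (`N ≥ 1`), for any set `S`. [folklore] -/
private theorem schnirelmannDensity_ge_of_count' {S : Set ℕ} [DecidablePred (· ∈ S)] {K : ℕ}
    (h : ∀ N : ℕ, 1 ≤ N → (N : ℝ) / K ≤ #{a ∈ Ioc 0 N | a ∈ S}) :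
    (1 : ℝ) / K ≤ schnirelmannDensity S := by
  rw [le_schnirelmannDensity_iff]
  intro n hn
  have hn' : (0 : ℝ) < n := by exact_mod_cast hn
  rw [le_div_iff₀ hn']
  have := h n hn
  calc (1 : ℝ) / K * n = (n : ℝ) / K := by ring
    _ ≤ _ := by convert this using 2

/-- `f(n) ≥ 1`. [folklore] -/
private theorem one_le_oddSingularFactor' (n : ℕ) : 1 ≤ oddSingularFactor n := by
  unfold oddSingularFactor
  have h : ∏ _p ∈ n.primeFactors.filter (2 < ·), (1 : ℝ)
      ≤ ∏ p ∈ n.primeFactors.filter (2 < ·), (((p : ℝ) - 1) / ((p : ℝ) - 2)) := by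
    refine Finset.prod_le_prod (fun _ _ => zero_le_one) fun p hp => ?_
    rw [Finset.mem_filter] at hp
    have hp3 : (3 : ℝ) ≤ p := by exact_mod_cast hp.2
    rw [le_div_iff₀ (by linarith)]
    linarith
  simpa using h

/-- `0 < log 1.01`. [folklore] -/
private theorem log_101_pos : 0 < Real.log ((101 : ℝ) / 100) := Real.log_pos (by norm_num)

/-- `log 1.01 ≤ 0.01`. [folklore] -/
private theorem log_101_le : Real.log ((101 : ℝ) / 100) ≤ 0.01 := by
  have h := Real.log_le_sub_one_of_pos (show (0 : ℝ) < 101 / 100 by norm_num)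
  have e : (101 : ℝ) / 100 - 1 = 0.01 := by norm_num
  rw [e] at h
  exact h

/-- Staircase / counting / numeric bookkeeping (verbatim private copy of an earlier module's helper). [folklore] -/
private theorem stairT_zero (x : ℕ) : stairT x 0 = x := by simp [stairT]

/-- Staircase / counting / numeric bookkeeping (verbatim private copy of an earlier module's helper). [folklore] -/
private theorem stairT_succ (x j : ℕ) : stairT x j = (101 / 100) * stairT x (j + 1) := by
  unfold stairT
  rw [pow_succ]
  field_simp

/-- Staircase / counting / numeric bookkeeping (verbatim private copy of an earlier module's helper). [folklore] -/
private theorem stairT_eq_mul_pow (x j : ℕ) : stairT x j = (x : ℝ) * ((100 : ℝ) / 101) ^ j := by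
  unfold stairT
  rw [div_eq_mul_inv, ← inv_pow]
  norm_num

/-- Staircase / counting / numeric bookkeeping (verbatim private copy of an earlier module's helper). [folklore] -/
private theorem stairT_nonneg (x j : ℕ) : 0 ≤ stairT x j := by unfold stairT; positivity

/-- Staircase / counting / numeric bookkeeping (verbatim private copy of an earlier module's helper). [folklore] -/
private theorem stairT_pos {x : ℕ} (hx : 0 < x) (j : ℕ) : 0 < stairT x j := by
  unfold stairT
  have : (0 : ℝ) < x := by exact_mod_cast hx
  positivity

/-- Staircase / counting / numeric bookkeeping (verbatim private copy of an earlier module's helper). [folklore] -/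
private theorem stairT_le_of_le (x : ℕ) {i j : ℕ} (hij : i ≤ j) : stairT x j ≤ stairT x i := by
  unfold stairT
  apply div_le_div_of_nonneg_left (Nat.cast_nonneg x) (by positivity)
  exact pow_le_pow_right₀ (by norm_num) hij

/-- Staircase / counting / numeric bookkeeping (verbatim private copy of an earlier module's helper). [folklore] -/
private theorem stairT_le_self (x j : ℕ) : stairT x j ≤ x := by
  have := stairT_le_of_le x (Nat.zero_le j)
  rwa [stairT_zero] at this

/-- Staircase / counting / numeric bookkeeping (verbatim private copy of an earlier module's helper). [folklore] -/
private theorem log_stairT {x : ℕ} (hx : 0 < x) (j : ℕ) : Real.log (stairT x j) = stairL x j := by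
  unfold stairT stairL
  have hx' : (0 : ℝ) < x := by exact_mod_cast hx
  rw [Real.log_div (ne_of_gt hx') (by positivity), Real.log_pow]

/-- Staircase / counting / numeric bookkeeping (verbatim private copy of an earlier module's helper). [folklore] -/
private theorem stairL_succ (x j : ℕ) : stairL x j = stairL x (j + 1) + Real.log ((101 : ℝ) / 100) := by
  unfold stairL; push_cast; ring

/-- Staircase / counting / numeric bookkeeping (verbatim private copy of an earlier module's helper). [folklore] -/
private theorem stairL_le_of_le (x : ℕ) {i j : ℕ} (hij : i ≤ j) : stairL x j ≤ stairL x i := by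
  unfold stairL
  have : (i : ℝ) ≤ j := by exact_mod_cast hij
  nlinarith [log_101_pos]

/-- `ℓ_j ≥ log x − 0.01·j`. [folklore] -/
private theorem stairL_ge (x j : ℕ) : Real.log (x : ℝ) - 0.01 * j ≤ stairL x j := by
  unfold stairL
  have hj : (0 : ℝ) ≤ j := Nat.cast_nonneg j
  nlinarith [log_101_le]

/-- A downward-closed subset of `range J` is an initial segment. [folklore] -/
private theorem filter_range_eq_range_card {p : ℕ → Prop} [DecidablePred p]
    (hp : ∀ i j, i ≤ j → p j → p i) (J : ℕ) :
    (range J).filter p = range #((range J).filter p) := by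
  set S := (range J).filter p with hS
  ext j
  rw [mem_range]
  constructor
  · intro hj
    have hsub : range (j + 1) ⊆ S := by
      intro i hi
      rw [mem_range] at hi
      rw [hS, mem_filter, mem_range] at hj ⊢
      exact ⟨by omega, hp i j (by omega) hj.2⟩
    have := card_le_card hsub
    rw [card_range] at this
    omega
  · intro hj
    by_contra hjS
    have hsub : S ⊆ range j := by
      intro i hi
      rw [mem_range]
      by_contra hij
      rw [not_lt] at hij
      apply hjS
      rw [hS, mem_filter, mem_range] at hi ⊢
      exact ⟨by omega, hp j i hij hi.2⟩
    have := card_le_card hsub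
    rw [card_range] at this
    omega

/-- Telescoping: `Σ_{j<s} c_j = Mf(s)`. [folklore] -/
private theorem sum_range_stairC (x s : ℕ) : ∑ j ∈ range s, stairC x j = stairMf x s := by
  unfold stairC
  rw [Finset.sum_range_sub]
  simp [stairMf]

/-- **The staircase identification**: for `N ≤ x` there is a block index `k < J` with `m(N) = M_k`,
`N ≤ t_k`, and `t_{k+1} < N` unless `k + 1 = J`. [folklore] -/
private theorem stairW_eq {x J N : ℕ} (hJ : 0 < J) (hNx : (N : ℝ) ≤ x) :
    ∃ k, k < J ∧ stairW x J N = stairM x k ∧ (N : ℝ) ≤ stairT x k ∧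
      (k + 1 < J → stairT x (k + 1) < N) := by
  set S := (range J).filter (fun j => (N : ℝ) ≤ stairT x j) with hS
  have hSeq : S = range #S :=
    filter_range_eq_range_card (fun i j hij hj => hj.trans (stairT_le_of_le x hij)) J
  have h0 : 0 ∈ S := by
    rw [hS, mem_filter, mem_range, stairT_zero]
    exact ⟨hJ, hNx⟩
  obtain ⟨k, hk⟩ : ∃ k, #S = k + 1 := ⟨#S - 1, by have := card_pos.mpr ⟨0, h0⟩; omega⟩
  rw [hk] at hSeq
  have hmem : ∀ j, j ∈ S ↔ j < k + 1 := fun j => by rw [hSeq, mem_range]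
  have hkS : k ∈ S := (hmem k).mpr (by omega)
  have hkS' := hkS
  rw [hS, mem_filter, mem_range] at hkS'
  refine ⟨k, hkS'.1, ?_, hkS'.2, fun hk1 => ?_⟩
  · unfold stairW
    rw [← hS, hSeq, sum_range_stairC]
    rfl
  · by_contra hle
    rw [not_lt] at hle
    have h1 : k + 1 ∈ S := by
      rw [hS, mem_filter, mem_range]
      exact ⟨hk1, hle⟩
    have := (hmem _).mp h1
    omega

/-- Staircase / counting / numeric bookkeeping (verbatim private copy of an earlier module's helper). [folklore] -/
private theorem stairC_zero (x : ℕ) : stairC x 0 = stairM x 0 := by simp [stairC, stairMf]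

/-- Staircase / counting / numeric bookkeeping (verbatim private copy of an earlier module's helper). [folklore] -/
private theorem stairC_succ (x j : ℕ) : stairC x (j + 1) = stairM x (j + 1) - stairM x j := by
  simp [stairC, stairMf]

/-- `M_j ≤ M_{j+1}` as soon as `ℓ_{j+2} ≥ 3`. [folklore] -/
private theorem stairM_mono {x : ℕ} (hx : 0 < x) {j : ℕ} (hℓ : 3 ≤ stairL x (j + 1 + 1)) :
    stairM x j ≤ stairM x (j + 1) := by
  unfold stairM
  have ht := stairT_pos hx (j + 1)
  rw [stairT_succ x j, div_le_div_iff₀ (by positivity) ht, stairL_succ x (j + 1)]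
  set l := stairL x (j + 1 + 1)
  set lam := Real.log ((101 : ℝ) / 100)
  have hlam := log_101_le
  have hlam0 := log_101_pos
  have h : (l + lam) ^ 2 ≤ 101 / 100 * l ^ 2 := by nlinarith
  nlinarith [mul_le_mul_of_nonneg_left h ht.le]

/-- `c_j ≥ 0` for `j < J` as soon as `ℓ_J ≥ 3`. [folklore] -/
private theorem stairC_nonneg {x : ℕ} (hx : 0 < x) {J j : ℕ} (hj : j < J) (hℓ : 3 ≤ stairL x J) :
    0 ≤ stairC x j := by
  cases j with
  | zero =>
      rw [stairC_zero]
      unfold stairM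
      exact div_nonneg (sq_nonneg _) (stairT_nonneg x 0)
  | succ i =>
      rw [stairC_succ, sub_nonneg]
      exact stairM_mono hx (hℓ.trans (stairL_le_of_le x (by omega)))

/-- **The swap**: `Σ_N r(N)·m(N) = Σ_j c_j·Σ_{N ≤ t_j} r(N)`. [folklore] -/
private theorem sum_mul_stairW (x J : ℕ) (E : Finset ℕ) (r : ℕ → ℝ) :
    ∑ N ∈ E, r N * stairW x J N
      = ∑ j ∈ range J, stairC x j * ∑ N ∈ E.filter (fun N : ℕ => (N : ℝ) ≤ stairT x j), r N := by
  unfold stairW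
  simp_rw [Finset.sum_filter, Finset.mul_sum]
  rw [Finset.sum_comm]
  refine sum_congr rfl fun j _ => sum_congr rfl fun N _ => ?_
  split_ifs <;> ring

/-- `{even N ≤ x : N ≤ t} = {even N ≤ ⌊t⌋}` for `0 ≤ t ≤ x`. [folklore] -/
private theorem filter_even_le_eq {x : ℕ} {t : ℝ} (ht0 : 0 ≤ t) (htx : t ≤ x) :
    ((range (x + 1)).filter Even).filter (fun N : ℕ => (N : ℝ) ≤ t) = (range (⌊t⌋₊ + 1)).filter Even := by
  ext N
  simp only [mem_filter, mem_range]
  constructor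
  · rintro ⟨⟨_, he⟩, hNt⟩
    exact ⟨by have := Nat.le_floor hNt; omega, he⟩
  · rintro ⟨hN, he⟩
    have hN' : N ≤ ⌊t⌋₊ := by omega
    have hNt : (N : ℝ) ≤ t := (Nat.le_floor_iff ht0).mp hN'
    have hNx : (N : ℝ) ≤ x := hNt.trans htx
    have hNx' : N ≤ x := by exact_mod_cast hNx
    exact ⟨⟨by omega, he⟩, hNt⟩

/-- **The level-`0` term**: `c_0·(x−1)²/ℓ_0² ≥ (1 − 0.01/Λ₀)²·(x − 2)` for `log x ≥ Λ₀ ≥ 1`. [folklore] -/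
private theorem stair_term_zero_ge {x : ℕ} (hx : 0 < x) {Λ₀ : ℝ} (hΛ₀ : 1 ≤ Λ₀) (hL : Λ₀ ≤ Real.log (x : ℝ)) :
    (1 - 0.01 / Λ₀) ^ 2 * ((x : ℝ) - 2)
      ≤ stairC x 0 * ((stairT x 0 - 1) ^ 2 / stairL x 0 ^ 2) := by
  rw [stairC_zero, stairT_zero]
  unfold stairM
  rw [stairT_zero]
  have hx' : (0 : ℝ) < x := by exact_mod_cast hx
  set L := Real.log (x : ℝ) with hL_def
  set lam := Real.log ((101 : ℝ) / 100)
  have hlam := log_101_le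
  have hlam0 := log_101_pos
  have hL0 : 0 < L := by linarith
  have hl0 : stairL x 0 = L := by simp [stairL, hL_def]
  have hl1 : stairL x (0 + 1) = L - lam := by simp [stairL, hL_def, lam]
  rw [hl0, hl1]
  -- `(L - lam)^2/x * ((x-1)^2/L^2) = ((L-lam)/L)^2 * ((x-1)^2/x) ≥ (1 - 0.01/Λ₀)^2 * (x - 2)`
  have h1 : 1 - 0.01 / Λ₀ ≤ (L - lam) / L := by
    rw [le_div_iff₀ hL0]
    have : lam ≤ 0.01 / Λ₀ * L := by
      have h2 : 0.01 / Λ₀ * Λ₀ = 0.01 := by field_simp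
      nlinarith [div_nonneg (by norm_num : (0:ℝ) ≤ 0.01) (by linarith : (0:ℝ) ≤ Λ₀)]
    nlinarith
  have h0 : 0 ≤ 1 - 0.01 / Λ₀ := by
    have : 0.01 / Λ₀ ≤ 0.01 / 1 := div_le_div_of_nonneg_left (by norm_num) (by norm_num) hΛ₀
    linarith
  have h2 : (1 - 0.01 / Λ₀) ^ 2 ≤ ((L - lam) / L) ^ 2 := pow_le_pow_left₀ h0 h1 2
  have h3 : (x : ℝ) - 2 ≤ ((x : ℝ) - 1) ^ 2 / x := by
    rw [le_div_iff₀ hx']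
    nlinarith
  have e : (L - lam) ^ 2 / (x : ℝ) * (((x : ℝ) - 1) ^ 2 / L ^ 2) = ((L - lam) / L) ^ 2 * (((x : ℝ) - 1) ^ 2 / x) := by
    rw [div_pow]
    field_simp
  rw [e]
  by_cases hx2 : (x : ℝ) - 2 ≤ 0
  · have : 0 ≤ ((L - lam) / L) ^ 2 * (((x : ℝ) - 1) ^ 2 / x) := by positivity
    nlinarith [sq_nonneg (1 - 0.01 / Λ₀)]
  · rw [not_le] at hx2
    exact mul_le_mul h2 h3 hx2.le (by positivity)

/-- **The level-`(k+1)` terms**: `c_{k+1}·(t_{k+1} − 1)²/ℓ_{k+1}² ≥ ((1 − 0.01/ℓ*)² − 100/101)·(t_{k+1} − 2)`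
whenever `3 ≤ ℓ* ≤ ℓ_{k+1}` and `t_{k+1} ≥ 2`. [folklore] -/
private theorem stair_term_succ_ge {x : ℕ} {ls : ℝ} (hls : 3 ≤ ls) {k : ℕ}
    (hℓ : ls ≤ stairL x (k + 1)) (ht2 : 2 ≤ stairT x (k + 1)) :
    ((1 - 0.01 / ls) ^ 2 - 100 / 101) * (stairT x (k + 1) - 2)
      ≤ stairC x (k + 1) * ((stairT x (k + 1) - 1) ^ 2 / stairL x (k + 1) ^ 2) := by
  rw [stairC_succ]
  unfold stairM
  rw [stairT_succ x k]
  set t := stairT x (k + 1) with ht_def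
  set l1 := stairL x (k + 1) with hl1_def
  set l2 := stairL x (k + 1 + 1) with hl2_def
  set lam := Real.log ((101 : ℝ) / 100)
  set β := (1 - 0.01 / ls) ^ 2 with hβ
  have hlam := log_101_le
  have hlam0 := log_101_pos
  have ht0 : 0 < t := by linarith
  have hls0 : 0 < ls := by linarith
  have hl10 : 0 < l1 := by linarith
  have hl12 : l1 = l2 + lam := stairL_succ x (k + 1)
  -- `(1 - 0.01/ls) * l1 ≤ l2`
  have hq : 0 ≤ 1 - 0.01 / ls := by
    have : 0.01 / ls ≤ 0.01 / 3 := div_le_div_of_nonneg_left (by norm_num) (by norm_num) hls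
    linarith
  have hge : (1 - 0.01 / ls) * l1 ≤ l2 := by
    have e1 : (1 - 0.01 / ls) * l1 = l1 - 0.01 * (l1 / ls) := by ring
    have h2 : 1 ≤ l1 / ls := by rw [le_div_iff₀ hls0]; linarith
    rw [e1]
    nlinarith
  have hsq : β * l1 ^ 2 ≤ l2 ^ 2 := by
    have h0 : 0 ≤ (1 - 0.01 / ls) * l1 := mul_nonneg hq hl10.le
    calc β * l1 ^ 2 = ((1 - 0.01 / ls) * l1) ^ 2 := by rw [hβ]; ring
      _ ≤ l2 ^ 2 := pow_le_pow_left₀ h0 hge 2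
  have hδ0 : 0 ≤ β - 100 / 101 := by
    have : 0.01 / ls ≤ 0.01 / 3 := div_le_div_of_nonneg_left (by norm_num) (by norm_num) hls
    rw [hβ]
    nlinarith
  -- the algebra
  have e1 : (l2 ^ 2 / t - l1 ^ 2 / (101 / 100 * t)) * ((t - 1) ^ 2 / l1 ^ 2)
      = (l2 ^ 2 - 100 / 101 * l1 ^ 2) * (t - 1) ^ 2 / (t * l1 ^ 2) := by
    field_simp
  have h2 : (β * l1 ^ 2 - 100 / 101 * l1 ^ 2) * (t - 1) ^ 2 / (t * l1 ^ 2)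
      ≤ (l2 ^ 2 - 100 / 101 * l1 ^ 2) * (t - 1) ^ 2 / (t * l1 ^ 2) := by
    apply div_le_div_of_nonneg_right _ (by positivity)
    exact mul_le_mul_of_nonneg_right (by linarith) (sq_nonneg _)
  have e3 : (β * l1 ^ 2 - 100 / 101 * l1 ^ 2) * (t - 1) ^ 2 / (t * l1 ^ 2) = (β - 100 / 101) * ((t - 1) ^ 2 / t) := by
    field_simp
  have h4 : (β - 100 / 101) * (t - 2) ≤ (β - 100 / 101) * ((t - 1) ^ 2 / t) := by
    apply mul_le_mul_of_nonneg_left _ hδ0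
    rw [le_div_iff₀ ht0]
    nlinarith
  rw [e1]
  linarith [h2, e3, h4]

/-- The geometric sum `Σ_{k<n} (100/101)^{k+1} = 100·(1 − (100/101)^n)`. [folklore] -/
private theorem geom_sum_101 (n : ℕ) :
    ∑ k ∈ range n, ((100 : ℝ) / 101) ^ (k + 1) = 100 * (1 - ((100 : ℝ) / 101) ^ n) := by
  induction n with
  | zero => simp
  | succ n ih => rw [sum_range_succ, ih, pow_succ]; ring

/-- Staircase / counting / numeric bookkeeping (verbatim private copy of an earlier module's helper). [folklore] -/
private theorem stairW_nonneg {x : ℕ} (hx : 0 < x) {J : ℕ} (hℓ : 3 ≤ stairL x J) (N : ℕ) : 0 ≤ stairW x J N := by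
  unfold stairW
  refine sum_nonneg fun j hj => ?_
  rw [mem_filter, mem_range] at hj
  exact stairC_nonneg hx hj.1 hℓ

/-- `(Σ_T u)² ≤ |T|·Σ_T u²`. [folklore] -/
private theorem sq_sum_le_card_mul_sum_sq' (T : Finset ℕ) (u : ℕ → ℝ) :
    (∑ N ∈ T, u N) ^ 2 ≤ (#T : ℝ) * ∑ N ∈ T, u N ^ 2 := by
  have h := sum_mul_sq_le_sq_mul_sq T u (fun _ => (1 : ℝ))
  simp only [mul_one, one_pow, sum_const, nsmul_eq_mul] at h
  linarith

/-- **Hölder, exponent 8**: `(Σ_T u)⁸ ≤ |T|⁷·Σ_T u⁸` for `u ≥ 0` on `T`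
(`(Σu)² ≤ n·Σu²`, `(Σu²)² ≤ n·Σu⁴`, `(Σu⁴)² ≤ n·Σu⁸`). [folklore] -/
private theorem pow8_sum_le (T : Finset ℕ) (u : ℕ → ℝ) (hu : ∀ N ∈ T, 0 ≤ u N) :
    (∑ N ∈ T, u N) ^ 8 ≤ (#T : ℝ) ^ 7 * ∑ N ∈ T, u N ^ 8 := by
  set n : ℝ := (#T : ℝ) with hn
  have hn0 : 0 ≤ n := by positivity
  have hS1 : 0 ≤ ∑ N ∈ T, u N := sum_nonneg hu
  have hS2 : 0 ≤ ∑ N ∈ T, u N ^ 2 := sum_nonneg fun N _ => by positivity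
  have hS4 : 0 ≤ ∑ N ∈ T, u N ^ 4 := sum_nonneg fun N _ => by positivity
  have h1 : (∑ N ∈ T, u N) ^ 2 ≤ n * ∑ N ∈ T, u N ^ 2 := sq_sum_le_card_mul_sum_sq' T u
  have h2 : (∑ N ∈ T, u N ^ 2) ^ 2 ≤ n * ∑ N ∈ T, u N ^ 4 := by
    have h := sq_sum_le_card_mul_sum_sq' T (fun N => u N ^ 2)
    have e : ∑ N ∈ T, (u N ^ 2) ^ 2 = ∑ N ∈ T, u N ^ 4 := sum_congr rfl fun N _ => by ring
    rw [e] at h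
    exact h
  have h3 : (∑ N ∈ T, u N ^ 4) ^ 2 ≤ n * ∑ N ∈ T, u N ^ 8 := by
    have h := sq_sum_le_card_mul_sum_sq' T (fun N => u N ^ 4)
    have e : ∑ N ∈ T, (u N ^ 4) ^ 2 = ∑ N ∈ T, u N ^ 8 := sum_congr rfl fun N _ => by ring
    rw [e] at h
    exact h
  have h1' : ((∑ N ∈ T, u N) ^ 2) ^ 4 ≤ (n * ∑ N ∈ T, u N ^ 2) ^ 4 :=
    pow_le_pow_left₀ (sq_nonneg _) h1 4
  have h2' : (∑ N ∈ T, u N ^ 2) ^ 4 ≤ (n * ∑ N ∈ T, u N ^ 4) ^ 2 := by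
    have := pow_le_pow_left₀ (sq_nonneg _) h2 2
    calc (∑ N ∈ T, u N ^ 2) ^ 4 = ((∑ N ∈ T, u N ^ 2) ^ 2) ^ 2 := by ring
      _ ≤ _ := this
  calc (∑ N ∈ T, u N) ^ 8 = ((∑ N ∈ T, u N) ^ 2) ^ 4 := by ring
    _ ≤ (n * ∑ N ∈ T, u N ^ 2) ^ 4 := h1'
    _ = n ^ 4 * (∑ N ∈ T, u N ^ 2) ^ 4 := by ring
    _ ≤ n ^ 4 * (n * ∑ N ∈ T, u N ^ 4) ^ 2 := mul_le_mul_of_nonneg_left h2' (by positivity)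
    _ = n ^ 6 * (∑ N ∈ T, u N ^ 4) ^ 2 := by ring
    _ ≤ n ^ 6 * (n * ∑ N ∈ T, u N ^ 8) := mul_le_mul_of_nonneg_left h3 (by positivity)
    _ = n ^ 7 * ∑ N ∈ T, u N ^ 8 := by ring

/-- `2⁵⁹ ≤ e⁴¹`. [folklore] -/
private theorem two_pow_59_le_exp_41 : (2 : ℝ) ^ 59 ≤ Real.exp 41 := by
  have he : (2.718281828 : ℝ) ≤ Real.exp 1 := by have := Real.exp_one_gt_d9; linarith
  have h := pow_le_pow_left₀ (by norm_num) he 41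
  rw [← Real.exp_nat_mul] at h
  norm_num at h
  exact le_trans (by norm_num) h

/-- `e¹³ ≥ 442000`. [folklore] -/
private theorem exp_13_ge : (442000 : ℝ) ≤ Real.exp 13 := by
  have he : (2.718281828 : ℝ) ≤ Real.exp 1 := by have := Real.exp_one_gt_d9; linarith
  have h := pow_le_pow_left₀ (by norm_num) he 13
  rw [← Real.exp_nat_mul] at h
  norm_num at h
  exact le_trans (by norm_num) h

/-- `2(x + 1) ≤ 10⁻⁴·x²/log²x` for `x ≥ e^41` (`log²x ≤ 2.4367√x`, `√x ≥ 2^29`). [folklore] -/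
private theorem two_mul_succ_le_small41 {x : ℕ} (hx : Real.exp 41 ≤ (x : ℝ)) :
    2 * ((x : ℝ) + 1) ≤ 0.0001 * ((x : ℝ) ^ 2 / Real.log x ^ 2) := by
  have hx1 : (1 : ℝ) < x := lt_of_lt_of_le (by have := Real.add_one_le_exp (41 : ℝ); linarith) hx
  have hx0 : (0 : ℝ) < x := by linarith
  set L := Real.log x with hL
  have hL41 : 41 ≤ L := by
    have := Real.log_le_log (Real.exp_pos 41) hx
    rwa [Real.log_exp] at this
  have hLpos : 0 < L ^ 2 := by positivity
  have hL4 : L ^ 4 ≤ 4096 * Real.sqrt x := log_pow_four_le_sqrt hx1.le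
  have hLsq : (1681 : ℝ) ≤ L ^ 2 := by nlinarith
  have hL2 : L ^ 2 ≤ 2.4367 * Real.sqrt x := by
    have e : L ^ 4 = L ^ 2 * L ^ 2 := by ring
    nlinarith [Real.sqrt_nonneg (x : ℝ)]
  have hbig : (2 : ℝ) ^ 59 ≤ x := two_pow_59_le_exp_41.trans hx
  have hsx : (2 : ℝ) ^ 29 ≤ Real.sqrt x :=
    Real.le_sqrt_of_sq_le (by
      rw [show ((2 : ℝ) ^ 29) ^ 2 = (2 : ℝ) ^ 58 by norm_num]
      exact le_trans (by norm_num) hbig)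
  have hxx : Real.sqrt x * Real.sqrt x = x := Real.mul_self_sqrt hx0.le
  have key : 2 * ((x : ℝ) + 1) * L ^ 2 ≤ 0.0001 * (x : ℝ) ^ 2 := by
    have h1 : 2 * ((x : ℝ) + 1) * L ^ 2 ≤ 4 * x * (2.4367 * Real.sqrt x) := by
      have : 2 * ((x : ℝ) + 1) ≤ 4 * x := by linarith
      exact mul_le_mul this hL2 (by positivity) (by positivity)
    have h2 : (1 : ℝ) ≤ Real.sqrt x / 2 ^ 29 := by
      rw [le_div_iff₀ (by positivity)]; linarith
    calc 2 * ((x : ℝ) + 1) * L ^ 2 ≤ 4 * x * (2.4367 * Real.sqrt x) := h1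
      _ ≤ 4 * x * (2.4367 * Real.sqrt x) * (Real.sqrt x / 2 ^ 29) :=
          le_mul_of_one_le_right (by positivity) h2
      _ = (9.7468 / 2 ^ 29) * (x * (Real.sqrt x * Real.sqrt x)) := by ring
      _ = (9.7468 / 2 ^ 29) * (x : ℝ) ^ 2 := by rw [hxx]; ring
      _ ≤ 0.0001 * (x : ℝ) ^ 2 := mul_le_mul_of_nonneg_right (by norm_num) (by positivity)
  calc 2 * ((x : ℝ) + 1) = 2 * ((x : ℝ) + 1) * L ^ 2 / L ^ 2 := by field_simp
    _ ≤ 0.0001 * (x : ℝ) ^ 2 / L ^ 2 := div_le_div_of_nonneg_right key hLpos.le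
    _ = _ := by ring

/-- **First moment over even `N`, threshold `e^{Λs}`, `Λs ≥ 41`**: `S₁^{ev}(x) ≥ (c₁ − 10⁻⁴)·x²/log²x`. [folklore] -/
private theorem sum_even_goldbachCount_ge' {c₁ Λs : ℝ} (hΛs : 41 ≤ Λs) {x : ℕ} (hx : Real.exp Λs ≤ (x : ℝ))
    (hS₁ : c₁ * ((x : ℝ) ^ 2 / Real.log x ^ 2) ≤ ∑ N ∈ range (x + 1), (SingularSeries.goldbachCount N : ℝ)) :
    (c₁ - 0.0001) * ((x : ℝ) ^ 2 / Real.log x ^ 2)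
      ≤ ∑ N ∈ (range (x + 1)).filter Even, (SingularSeries.goldbachCount N : ℝ) := by
  have hsplit := sum_filter_add_sum_filter_not (range (x + 1)) Even
    (fun N => (SingularSeries.goldbachCount N : ℝ))
  have hodd := sum_goldbachCount_odd_le x
  have hsmall := two_mul_succ_le_small41 (((Real.exp_le_exp.mpr hΛs)).trans hx)
  have e : (c₁ - 0.0001) * ((x : ℝ) ^ 2 / Real.log x ^ 2)
      = c₁ * ((x : ℝ) ^ 2 / Real.log x ^ 2) - 0.0001 * ((x : ℝ) ^ 2 / Real.log x ^ 2) := by ring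
  rw [e]
  linarith

/-- **One level of the lower side, threshold `e^{Λs}`**: `Σ_{even N ≤ t_j} r(N) ≥ (c₁ − 10⁻⁴)·(t_j − 1)²/ℓ_j²`
when `t_j ≥ e^{Λs} + 1`. [folklore] -/
private theorem level_lower' {c₁ Λs : ℝ} (hΛs : 41 ≤ Λs)
    (hS₁ : ∀ y : ℕ, Real.exp Λs ≤ (y : ℝ) →
      c₁ * ((y : ℝ) ^ 2 / Real.log y ^ 2) ≤ ∑ N ∈ range (y + 1), (SingularSeries.goldbachCount N : ℝ))
    (hc₁ : 0.0001 ≤ c₁) {x j : ℕ} (hx : 0 < x) (ht : Real.exp Λs + 1 ≤ stairT x j) :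
    (c₁ - 0.0001) * ((stairT x j - 1) ^ 2 / stairL x j ^ 2)
      ≤ ∑ N ∈ ((range (x + 1)).filter Even).filter (fun N : ℕ => (N : ℝ) ≤ stairT x j),
          (SingularSeries.goldbachCount N : ℝ) := by
  set t := stairT x j with ht_def
  have heΛ : (1 : ℝ) < Real.exp Λs := by have := Real.add_one_le_exp Λs; linarith
  have ht0 : 0 ≤ t := by linarith
  set y := ⌊t⌋₊ with hy_def
  have hy1 : t - 1 ≤ y := (Nat.sub_one_lt_floor t).le
  have hyt : (y : ℝ) ≤ t := Nat.floor_le ht0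
  have hy : Real.exp Λs ≤ (y : ℝ) := by linarith
  have hy0 : (1 : ℝ) < y := by linarith
  rw [filter_even_le_eq ht0 (stairT_le_self x j)]
  have h := sum_even_goldbachCount_ge' hΛs hy (hS₁ y hy)
  refine le_trans ?_ h
  apply mul_le_mul_of_nonneg_left _ (by linarith)
  have hlogy : 0 < Real.log y := Real.log_pos hy0
  have hlogle : Real.log y ≤ stairL x j := by
    rw [← log_stairT hx]
    exact Real.log_le_log (by linarith) hyt
  calc (t - 1) ^ 2 / stairL x j ^ 2 ≤ (y : ℝ) ^ 2 / stairL x j ^ 2 :=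
        div_le_div_of_nonneg_right (pow_le_pow_left₀ (by linarith) hy1 2) (by positivity)
    _ ≤ (y : ℝ) ^ 2 / Real.log y ^ 2 :=
        div_le_div_of_nonneg_left (by positivity) (by positivity) (pow_le_pow_left₀ hlogy.le hlogle 2)

/-- `m(N) ≤ M_{J−1} = Σ_{j<J} c_j` (all increments are `≥ 0`). [folklore] -/
private theorem stairW_le_stairMf {x : ℕ} (hx : 0 < x) {J : ℕ} (hℓ : 3 ≤ stairL x J) (N : ℕ) :
    stairW x J N ≤ stairMf x J := by
  unfold stairW
  rw [← sum_range_stairC x J]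
  exact sum_le_sum_of_subset_of_nonneg (filter_subset _ _) fun j hj _ => stairC_nonneg hx (mem_range.mp hj) hℓ

/-- `((2y − 3 : ℕ) : ℝ) = 2y − 3` for `y ≥ 2`. [folklore] -/
private theorem cast_two_mul_sub_three {y : ℕ} (hy : 2 ≤ y) : ((2 * y - 3 : ℕ) : ℝ) = 2 * (y : ℝ) - 3 := by
  have h3y : 3 ≤ 2 * y := by omega
  rw [Nat.cast_sub h3y]
  push_cast
  ring

/-- `((2y − q : ℕ) : ℝ) = 2y − q` for `q ≤ 2y`. [folklore] -/
private theorem cast_two_mul_sub {y q : ℕ} (h : q ≤ 2 * y) : ((2 * y - q : ℕ) : ℝ) = 2 * (y : ℝ) - q := by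
  rw [Nat.cast_sub h]
  push_cast
  ring

/-- `f(2) = 1`. [folklore] -/
private theorem oddSingularFactor_two' : oddSingularFactor 2 = 1 := by
  rw [show (2 : ℕ) = 2 ^ 1 * 1 by norm_num, GoldbachLinnik.oddSingularFactor_two_pow_mul 1 one_ne_zero,
    GoldbachLinnik.oddSingularFactor_one]

/-- `f(4) = 1`. [folklore] -/
private theorem oddSingularFactor_four : oddSingularFactor 4 = 1 := by
  rw [show (4 : ℕ) = 2 ^ 2 * 1 by norm_num, GoldbachLinnik.oddSingularFactor_two_pow_mul 2 one_ne_zero,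
    GoldbachLinnik.oddSingularFactor_one]

/-- `f(8) = 1`. [folklore] -/
private theorem oddSingularFactor_eight : oddSingularFactor 8 = 1 := by
  rw [show (8 : ℕ) = 2 ^ 3 * 1 by norm_num, GoldbachLinnik.oddSingularFactor_two_pow_mul 3 one_ne_zero,
    GoldbachLinnik.oddSingularFactor_one]

/-- `f(6) = 2` (the factor `(3−1)/(3−2)`). [folklore] -/
private theorem oddSingularFactor_six : oddSingularFactor 6 = 2 := by
  rw [show (6 : ℕ) = 2 ^ 1 * 3 by norm_num, GoldbachLinnik.oddSingularFactor_two_pow_mul 1 (by norm_num)]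
  show ∏ p ∈ (Nat.primeFactors 3).filter (2 < ·), (((p : ℝ) - 1) / ((p : ℝ) - 2)) = 2
  rw [Nat.prime_three.primeFactors, Finset.filter_singleton, if_pos (by norm_num), Finset.prod_singleton]
  norm_num

/-- `ℓ² ≤ a²·e^{ℓ − a}` for `ℓ ≥ a ≥ 2` (`ℓ²e^{−ℓ}` is decreasing on `[2, ∞)`). [folklore] -/
private theorem sq_le_sq_mul_exp {a l : ℝ} (ha : 2 ≤ a) (hl : a ≤ l) : l ^ 2 ≤ a ^ 2 * Real.exp (l - a) := by
  set u := l - a with hu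
  have hu0 : 0 ≤ u := by linarith
  have ha0 : 0 ≤ a := by linarith
  have h1 : 1 + u / 2 ≤ Real.exp (u / 2) := by have := Real.add_one_le_exp (u / 2); linarith
  have h2 : (1 + u / 2) ^ 2 ≤ Real.exp (u / 2) ^ 2 := pow_le_pow_left₀ (by linarith) h1 2
  have h3 : Real.exp (u / 2) ^ 2 = Real.exp u := by rw [← Real.exp_nat_mul]; ring_nf
  rw [h3] at h2
  have hl' : l = a + u := by linarith
  rw [hl']
  have h4 : a ^ 2 * (1 + u / 2) ^ 2 ≤ a ^ 2 * Real.exp u := mul_le_mul_of_nonneg_left h2 (sq_nonneg a)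
  have h5 : 0 ≤ u * a * (a - 2) := mul_nonneg (mul_nonneg hu0 ha0) (sub_nonneg.2 ha)
  have h6 : 0 ≤ u ^ 2 * (a - 2) * (a + 2) := mul_nonneg (mul_nonneg (sq_nonneg u) (sub_nonneg.2 ha)) (by linarith)
  nlinarith [h4, h5, h6]

/-- `f(10) = 4/3`. [folklore] -/
private theorem oddSingularFactor_ten : oddSingularFactor 10 = 4 / 3 := by
  rw [show (10 : ℕ) = 2 ^ 1 * 5 by norm_num, GoldbachLinnik.oddSingularFactor_two_pow_mul 1 (by norm_num)]
  show ∏ p ∈ (Nat.primeFactors 5).filter (2 < ·), (((p : ℝ) - 1) / ((p : ℝ) - 2)) = 4 / 3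
  rw [Nat.prime_five.primeFactors, Finset.filter_singleton, if_pos (by norm_num), Finset.prod_singleton]
  norm_num

/-- `f(12) = 2`. [folklore] -/
private theorem oddSingularFactor_twelve : oddSingularFactor 12 = 2 := by
  rw [show (12 : ℕ) = 2 ^ 2 * 3 by norm_num, GoldbachLinnik.oddSingularFactor_two_pow_mul 2 (by norm_num)]
  show ∏ p ∈ (Nat.primeFactors 3).filter (2 < ·), (((p : ℝ) - 1) / ((p : ℝ) - 2)) = 2
  rw [Nat.prime_three.primeFactors, Finset.filter_singleton, if_pos (by norm_num), Finset.prod_singleton]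
  norm_num

/-- `f(14) = 6/5`. [folklore] -/
private theorem oddSingularFactor_fourteen : oddSingularFactor 14 = 6 / 5 := by
  rw [show (14 : ℕ) = 2 ^ 1 * 7 by norm_num, GoldbachLinnik.oddSingularFactor_two_pow_mul 1 (by norm_num)]
  show ∏ p ∈ (Nat.primeFactors 7).filter (2 < ·), (((p : ℝ) - 1) / ((p : ℝ) - 2)) = 6 / 5
  rw [(by norm_num : Nat.Prime 7).primeFactors, Finset.filter_singleton, if_pos (by norm_num), Finset.prod_singleton]
  norm_num

/-- `f(16) = 1`. [folklore] -/
private theorem oddSingularFactor_sixteen : oddSingularFactor 16 = 1 := by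
  rw [show (16 : ℕ) = 2 ^ 4 * 1 by norm_num, GoldbachLinnik.oddSingularFactor_two_pow_mul 4 one_ne_zero,
    GoldbachLinnik.oddSingularFactor_one]

/-- `f(18) = 2`. [folklore] -/
private theorem oddSingularFactor_eighteen : oddSingularFactor 18 = 2 := by
  rw [show (18 : ℕ) = 2 ^ 1 * 9 by norm_num, GoldbachLinnik.oddSingularFactor_two_pow_mul 1 (by norm_num)]
  show ∏ p ∈ (Nat.primeFactors 9).filter (2 < ·), (((p : ℝ) - 1) / ((p : ℝ) - 2)) = 2
  rw [show (9 : ℕ) = 3 ^ 2 by norm_num, Nat.primeFactors_prime_pow (by norm_num) Nat.prime_three,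
    Finset.filter_singleton, if_pos (by norm_num), Finset.prod_singleton]
  norm_num

/-- `f(20) = 4 / 3`. [folklore] -/
private theorem oddSingularFactor_twenty : oddSingularFactor 20 = 4 / 3 := by
  rw [show (20 : ℕ) = 2 ^ 2 * 5 by norm_num, GoldbachLinnik.oddSingularFactor_two_pow_mul 2 (by norm_num)]
  show ∏ p ∈ (Nat.primeFactors 5).filter (2 < ·), (((p : ℝ) - 1) / ((p : ℝ) - 2)) = 4 / 3
  rw [Nat.prime_five.primeFactors, Finset.filter_singleton, if_pos (by norm_num), Finset.prod_singleton]
  norm_num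

/-- `f(22) = 10 / 9`. [folklore] -/
private theorem oddSingularFactor_twentytwo : oddSingularFactor 22 = 10 / 9 := by
  rw [show (22 : ℕ) = 2 ^ 1 * 11 by norm_num, GoldbachLinnik.oddSingularFactor_two_pow_mul 1 (by norm_num)]
  show ∏ p ∈ (Nat.primeFactors 11).filter (2 < ·), (((p : ℝ) - 1) / ((p : ℝ) - 2)) = 10 / 9
  rw [(by norm_num : Nat.Prime 11).primeFactors, Finset.filter_singleton, if_pos (by norm_num), Finset.prod_singleton]
  norm_num

/-- `f(24) = 2`. [folklore] -/
private theorem oddSingularFactor_twentyfour : oddSingularFactor 24 = 2 := by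
  rw [show (24 : ℕ) = 2 ^ 3 * 3 by norm_num, GoldbachLinnik.oddSingularFactor_two_pow_mul 3 (by norm_num)]
  show ∏ p ∈ (Nat.primeFactors 3).filter (2 < ·), (((p : ℝ) - 1) / ((p : ℝ) - 2)) = 2
  rw [Nat.prime_three.primeFactors, Finset.filter_singleton, if_pos (by norm_num), Finset.prod_singleton]
  norm_num

/-- `f(26) = 12 / 11`. [folklore] -/
private theorem oddSingularFactor_twentysix : oddSingularFactor 26 = 12 / 11 := by
  rw [show (26 : ℕ) = 2 ^ 1 * 13 by norm_num, GoldbachLinnik.oddSingularFactor_two_pow_mul 1 (by norm_num)]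
  show ∏ p ∈ (Nat.primeFactors 13).filter (2 < ·), (((p : ℝ) - 1) / ((p : ℝ) - 2)) = 12 / 11
  rw [(by norm_num : Nat.Prime 13).primeFactors, Finset.filter_singleton, if_pos (by norm_num), Finset.prod_singleton]
  norm_num

/-- `f(28) = 6 / 5`. [folklore] -/
private theorem oddSingularFactor_twentyeight : oddSingularFactor 28 = 6 / 5 := by
  rw [show (28 : ℕ) = 2 ^ 2 * 7 by norm_num, GoldbachLinnik.oddSingularFactor_two_pow_mul 2 (by norm_num)]
  show ∏ p ∈ (Nat.primeFactors 7).filter (2 < ·), (((p : ℝ) - 1) / ((p : ℝ) - 2)) = 6 / 5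
  rw [(by norm_num : Nat.Prime 7).primeFactors, Finset.filter_singleton, if_pos (by norm_num), Finset.prod_singleton]
  norm_num

/-- `f(30) = 8 / 3`. [folklore] -/
private theorem oddSingularFactor_thirty : oddSingularFactor 30 = 8 / 3 := by
  rw [show (30 : ℕ) = 2 ^ 1 * 15 by norm_num, GoldbachLinnik.oddSingularFactor_two_pow_mul 1 (by norm_num)]
  show ∏ p ∈ (Nat.primeFactors 15).filter (2 < ·), (((p : ℝ) - 1) / ((p : ℝ) - 2)) = 8 / 3
  rw [show (15 : ℕ) = 3 * 5 by norm_num, Nat.primeFactors_mul (by norm_num) (by norm_num),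
    Nat.prime_three.primeFactors, Nat.prime_five.primeFactors, Finset.filter_union, Finset.filter_singleton,
    Finset.filter_singleton, if_pos (by norm_num), if_pos (by norm_num), Finset.prod_union (by simp),
    Finset.prod_singleton, Finset.prod_singleton]
  norm_num

/-- `f(32) = 1`. [folklore] -/
private theorem oddSingularFactor_thirtytwo : oddSingularFactor 32 = 1 := by
  rw [show (32 : ℕ) = 2 ^ 5 * 1 by norm_num, GoldbachLinnik.oddSingularFactor_two_pow_mul 5 one_ne_zero,
    GoldbachLinnik.oddSingularFactor_one]

/-- `f(34) = 16 / 15`. [folklore] -/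
private theorem oddSingularFactor_thirtyfour : oddSingularFactor 34 = 16 / 15 := by
  rw [show (34 : ℕ) = 2 ^ 1 * 17 by norm_num, GoldbachLinnik.oddSingularFactor_two_pow_mul 1 (by norm_num)]
  show ∏ p ∈ (Nat.primeFactors 17).filter (2 < ·), (((p : ℝ) - 1) / ((p : ℝ) - 2)) = 16 / 15
  rw [(by norm_num : Nat.Prime 17).primeFactors, Finset.filter_singleton, if_pos (by norm_num), Finset.prod_singleton]
  norm_num

/-- `f(36) = 2`. [folklore] -/
private theorem oddSingularFactor_thirtysix : oddSingularFactor 36 = 2 := by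
  rw [show (36 : ℕ) = 2 ^ 2 * 9 by norm_num, GoldbachLinnik.oddSingularFactor_two_pow_mul 2 (by norm_num)]
  show ∏ p ∈ (Nat.primeFactors 9).filter (2 < ·), (((p : ℝ) - 1) / ((p : ℝ) - 2)) = 2
  rw [show (9 : ℕ) = 3 ^ 2 by norm_num, Nat.primeFactors_prime_pow (by norm_num) Nat.prime_three,
    Finset.filter_singleton, if_pos (by norm_num), Finset.prod_singleton]
  norm_num

/-- `f(38) = 18 / 17`. [folklore] -/
private theorem oddSingularFactor_thirtyeight : oddSingularFactor 38 = 18 / 17 := by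
  rw [show (38 : ℕ) = 2 ^ 1 * 19 by norm_num, GoldbachLinnik.oddSingularFactor_two_pow_mul 1 (by norm_num)]
  show ∏ p ∈ (Nat.primeFactors 19).filter (2 < ·), (((p : ℝ) - 1) / ((p : ℝ) - 2)) = 18 / 17
  rw [(by norm_num : Nat.Prime 19).primeFactors, Finset.filter_singleton, if_pos (by norm_num), Finset.prod_singleton]
  norm_num

/-- `(100/101)¹⁹⁹ ≤ 0.1385`. [folklore] -/
private theorem q_pow_199_le' : ((100 : ℝ) / 101) ^ 199 ≤ 0.1385 := by norm_num

/-- `(100/101)³⁹⁹ ≤ 1/52` (`0.1385²·100/101 = 0.01899…`). [folklore] -/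
private theorem q_pow_399_le : ((100 : ℝ) / 101) ^ 399 ≤ 1 / 52 := by
  have h := q_pow_199_le'
  have h0 : (0 : ℝ) ≤ ((100 : ℝ) / 101) ^ 199 := by positivity
  have e : ((100 : ℝ) / 101) ^ 399 = ((100 : ℝ) / 101) ^ 199 * ((100 : ℝ) / 101) ^ 199 * ((100 : ℝ) / 101) := by
    rw [← pow_add, ← pow_succ]
  rw [e]
  have h2 : ((100 : ℝ) / 101) ^ 199 * ((100 : ℝ) / 101) ^ 199 ≤ 0.1385 * 0.1385 := mul_le_mul h h h0 (by norm_num)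
  nlinarith [h2]

/-- **The lower side, summed over `J = 400` levels**: `Σ_{j<400} c_j·(t_j − 1)²/ℓ_j² ≥ gHol4(Λ₀)·x − 21`
for `log x ≥ Λ₀ ≥ 44`. [folklore] -/
private theorem stair_lower_sum_ge400 {x : ℕ} (hx : 0 < x) {Λ₀ : ℝ} (hΛ₀ : 44 ≤ Λ₀) (hL : Λ₀ ≤ Real.log (x : ℝ))
    (hx2 : (2 : ℝ) ≤ stairT x 400) :
    gHol4 Λ₀ * (x : ℝ) - 21 ≤ ∑ j ∈ range 400, stairC x j * ((stairT x j - 1) ^ 2 / stairL x j ^ 2) := by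
  rw [sum_range_succ']
  set ls := Λ₀ - 4 with hls_def
  have hls3 : 3 ≤ ls := by linarith
  set δ := (1 - 0.01 / ls) ^ 2 - 100 / 101 with hδ_def
  have hδ0 : 0 ≤ δ := by
    have : 0.01 / ls ≤ 0.01 / 3 := div_le_div_of_nonneg_left (by norm_num) (by norm_num) hls3
    rw [hδ_def]
    nlinarith
  have hδ1 : δ ≤ 0.01 := by
    have h0 : 0 ≤ 0.01 / ls := by positivity
    have : 0.01 / ls ≤ 0.01 / 3 := div_le_div_of_nonneg_left (by norm_num) (by norm_num) hls3
    rw [hδ_def]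
    nlinarith
  -- the terms `k+1`, `k < 399`
  have hterm : ∀ k ∈ range 399, δ * (stairT x (k + 1) - 2)
      ≤ stairC x (k + 1) * ((stairT x (k + 1) - 1) ^ 2 / stairL x (k + 1) ^ 2) := by
    intro k hk
    rw [mem_range] at hk
    apply stair_term_succ_ge hls3
    · have h1 := stairL_le_of_le x (show k + 1 ≤ 400 by omega)
      have h2 := stairL_ge x 400
      have : ls ≤ Real.log (x : ℝ) - 0.01 * ((400 : ℕ) : ℝ) := by push_cast; linarith
      linarith
    · exact hx2.trans (stairT_le_of_le x (by omega))
  have hsum1 : δ * ((x : ℝ) * (100 * (1 - ((100 : ℝ) / 101) ^ 399)) - 2 * 399)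
      ≤ ∑ k ∈ range 399, stairC x (k + 1) * ((stairT x (k + 1) - 1) ^ 2 / stairL x (k + 1) ^ 2) := by
    have h := sum_le_sum hterm
    have e : ∑ k ∈ range 399, δ * (stairT x (k + 1) - 2)
        = δ * ((x : ℝ) * (100 * (1 - ((100 : ℝ) / 101) ^ 399)) - 2 * 399) := by
      rw [← mul_sum, sum_sub_distrib, sum_const, card_range, ← geom_sum_101, mul_sum]
      simp only [stairT_eq_mul_pow, nsmul_eq_mul]
      push_cast
      ring
    rw [← e]
    exact h
  have hterm0 := stair_term_zero_ge hx (by linarith : (1 : ℝ) ≤ Λ₀) hL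
  have hq399 : ((100 : ℝ) / 101) ^ 399 ≤ 1 / 52 := q_pow_399_le
  have hx' : (0 : ℝ) < x := by exact_mod_cast hx
  generalize hQ : ((100 : ℝ) / 101) ^ 399 = Q at hq399 hsum1
  clear hQ
  have hmain : gHol4 Λ₀ * (x : ℝ) - 21
      ≤ (1 - 0.01 / Λ₀) ^ 2 * ((x : ℝ) - 2)
        + δ * ((x : ℝ) * (100 * (1 - Q)) - 2 * 399) := by
    have hS : 98.07 ≤ 100 * (1 - Q) := by linarith [hq399]
    have h1 : 98.07 * (x : ℝ) ≤ (x : ℝ) * (100 * (1 - Q)) := by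
      nlinarith [mul_le_mul_of_nonneg_left hS hx'.le]
    have h2 : (1 - 0.01 / Λ₀) ^ 2 ≤ 1 := by
      have h0 : 0 ≤ 0.01 / Λ₀ := by positivity
      have : 0.01 / Λ₀ ≤ 0.01 / 44 := div_le_div_of_nonneg_left (by norm_num) (by norm_num) hΛ₀
      nlinarith
    have hA : (1 - 0.01 / Λ₀) ^ 2 * (x : ℝ) - 2 ≤ (1 - 0.01 / Λ₀) ^ 2 * ((x : ℝ) - 2) := by
      nlinarith [sq_nonneg (1 - 0.01 / Λ₀)]
    have hB : 98.07 * δ * (x : ℝ) - 19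
        ≤ δ * ((x : ℝ) * (100 * (1 - Q)) - 2 * 399) := by
      have h3 := mul_le_mul_of_nonneg_left h1 hδ0
      nlinarith [hδ1]
    have e : gHol4 Λ₀ * (x : ℝ) = (1 - 0.01 / Λ₀) ^ 2 * (x : ℝ) + 98.07 * δ * (x : ℝ) := by
      unfold gHol4
      rw [← hls_def, ← hδ_def]
      ring
    linarith [hA, hB, e]
  linarith [hmain, hterm0, hsum1]

/-- **Main blocks, `J = 400`**: for even `N` with `t_{400} < N ≤ x`, `r(N)·m(N) ≤ A·f(N)`. [folklore] -/
private theorem stair_rm_le_main400 {x : ℕ} (hx : 0 < x) {Λ A : ℝ} (hΛ0 : 0 < Λ) (hA : 0 ≤ A)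
    (hpt : ∀ N : ℕ, Real.exp Λ ≤ (N : ℝ) → Even N →
      (SingularSeries.goldbachCount N : ℝ) ≤ A * oddSingularFactor N * (N : ℝ) / Real.log (N : ℝ) ^ 2)
    (hbot : Real.exp Λ ≤ stairT x 400) {N : ℕ} (heven : Even N) (hNx : (N : ℝ) ≤ x)
    (hNt : stairT x 400 < N) :
    (SingularSeries.goldbachCount N : ℝ) * stairW x 400 N ≤ A * oddSingularFactor N := by
  obtain ⟨k, hk, hW, hNk, hnext⟩ := stairW_eq (x := x) (J := 400) (N := N) (by norm_num) hNx
  have htk1 : stairT x (k + 1) < N := by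
    by_cases h : k + 1 < 400
    · exact hnext h
    · have : k + 1 = 400 := by omega
      rw [this]; exact hNt
  have hNΛ : Real.exp Λ ≤ (N : ℝ) := hbot.trans hNt.le
  have hN1 : (1 : ℝ) < N := lt_of_lt_of_le (by have := Real.add_one_le_exp Λ; linarith) hNΛ
  have hlogN : 0 < Real.log (N : ℝ) := Real.log_pos hN1
  have hr := hpt N hNΛ heven
  have hf := oddSingularFactor_nonneg N
  have hΛℓ : Λ ≤ stairL x 400 := by
    rw [← log_stairT hx]
    have := Real.log_le_log (Real.exp_pos Λ) hbot
    rwa [Real.log_exp] at this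
  have hl0 : 0 ≤ stairL x (k + 1) := (hΛ0.le.trans hΛℓ).trans (stairL_le_of_le x (by omega))
  have hl : stairL x (k + 1) ≤ Real.log (N : ℝ) := by
    rw [← log_stairT hx]
    exact Real.log_le_log (stairT_pos hx _) htk1.le
  have h1 : stairL x (k + 1) ^ 2 ≤ Real.log (N : ℝ) ^ 2 := pow_le_pow_left₀ hl0 hl 2
  have htk : 0 < stairT x k := stairT_pos hx k
  have hN0 : (0 : ℝ) < N := by linarith
  rw [hW]
  unfold stairM
  calc (SingularSeries.goldbachCount N : ℝ) * (stairL x (k + 1) ^ 2 / stairT x k)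
      ≤ A * oddSingularFactor N * (N : ℝ) / Real.log (N : ℝ) ^ 2 * (stairL x (k + 1) ^ 2 / stairT x k) :=
        mul_le_mul_of_nonneg_right hr (div_nonneg (sq_nonneg _) htk.le)
    _ = A * oddSingularFactor N * (((N : ℝ) / stairT x k) * (stairL x (k + 1) ^ 2 / Real.log (N : ℝ) ^ 2)) := by
        field_simp
    _ ≤ A * oddSingularFactor N * 1 := by
        apply mul_le_mul_of_nonneg_left _ (mul_nonneg hA hf)
        exact mul_le_one₀ ((div_le_one htk).mpr hNk) (div_nonneg (sq_nonneg _) (sq_nonneg _))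
          ((div_le_one (pow_pos hlogN 2)).mpr h1)
    _ = A * oddSingularFactor N := mul_one _

/-- **The bottom segment, `J = 400`**: for even `e^Λ ≤ N ≤ t_{400}`, `r(N)·m(N) ≤ A·f(N)`
(`m(N) = ℓ_{400}²/t_{399}`, `N/log²N ≤ t_{400}/ℓ_{400}²`, `t_{400} ≤ t_{399}`). [folklore] -/
private theorem stair_rm_le_bottom400 {x : ℕ} (hx : 0 < x) {Λ A : ℝ} (hΛ2 : 2 ≤ Λ) (hA : 0 ≤ A)
    (hpt : ∀ N : ℕ, Real.exp Λ ≤ (N : ℝ) → Even N →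
      (SingularSeries.goldbachCount N : ℝ) ≤ A * oddSingularFactor N * (N : ℝ) / Real.log (N : ℝ) ^ 2)
    {N : ℕ} (heven : Even N) (hNΛ : Real.exp Λ ≤ (N : ℝ)) (hNt : (N : ℝ) ≤ stairT x 400) :
    (SingularSeries.goldbachCount N : ℝ) * stairW x 400 N ≤ A * oddSingularFactor N := by
  have hNx : (N : ℝ) ≤ x := hNt.trans (stairT_le_self x 400)
  obtain ⟨k, hk, hW, hNk, hnext⟩ := stairW_eq (x := x) (J := 400) (N := N) (by norm_num) hNx
  have hk399 : k = 399 := by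
    by_contra hne
    have hlt : k + 1 < 400 := by omega
    have h1 := hnext hlt
    have h2 := stairT_le_of_le x (show k + 1 ≤ 400 by omega)
    linarith
  subst hk399
  rw [hW]
  unfold stairM
  have ht399 := stairT_pos hx 399
  have ht400 := stairT_pos hx 400
  have hℓ : Real.log (stairT x 400) = stairL x (399 + 1) := log_stairT hx 400
  have hr := hpt N hNΛ heven
  have he2 : Real.exp 2 ≤ (N : ℝ) := le_trans (Real.exp_le_exp.mpr hΛ2) hNΛ
  have hmono := div_log_sq_mono he2 hNt
  rw [hℓ] at hmono
  have hN1 : (1 : ℝ) < N := lt_of_lt_of_le (by have := Real.add_one_le_exp (2 : ℝ); linarith) he2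
  have hlogN : 0 < Real.log (N : ℝ) := Real.log_pos hN1
  have hf := oddSingularFactor_nonneg N
  calc (SingularSeries.goldbachCount N : ℝ) * (stairL x (399 + 1) ^ 2 / stairT x 399)
      ≤ A * oddSingularFactor N * (N : ℝ) / Real.log (N : ℝ) ^ 2 * (stairL x (399 + 1) ^ 2 / stairT x 399) :=
        mul_le_mul_of_nonneg_right hr (div_nonneg (sq_nonneg _) ht399.le)
    _ = A * oddSingularFactor N * ((N : ℝ) / Real.log (N : ℝ) ^ 2) * (stairL x (399 + 1) ^ 2 / stairT x 399) := by
        ring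
    _ ≤ A * oddSingularFactor N * (stairT x 400 / stairL x (399 + 1) ^ 2)
          * (stairL x (399 + 1) ^ 2 / stairT x 399) :=
        mul_le_mul_of_nonneg_right (mul_le_mul_of_nonneg_left hmono (mul_nonneg hA hf))
          (div_nonneg (sq_nonneg _) ht399.le)
    _ ≤ A * oddSingularFactor N * 1 := by
        rw [mul_assoc (A * oddSingularFactor N)]
        apply mul_le_mul_of_nonneg_left _ (mul_nonneg hA hf)
        have hℓ0 : 0 < stairL x (399 + 1) := by
          rw [← hℓ]
          have h1 := Real.log_le_log (by positivity) (hNΛ.trans hNt)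
          have h2 : Real.log (N : ℝ) ≤ Real.log (stairT x 400) := Real.log_le_log (by linarith) hNt
          linarith
        calc stairT x 400 / stairL x (399 + 1) ^ 2 * (stairL x (399 + 1) ^ 2 / stairT x 399)
            = stairT x 400 / stairT x 399 := by field_simp
          _ ≤ 1 := (div_le_one ht399).mpr (stairT_le_of_le x (by norm_num))
    _ = A * oddSingularFactor N := mul_one _

set_option maxHeartbeats 1600000 in

/-- `e^{2.0796} ≥ 8.00096 = 8·1.00012` (`2.0796 = 3·0.6931471808 + 0.0001584576`). [folklore] -/
private theorem exp_20796_ge : (8.00096 : ℝ) ≤ Real.exp 2.0796 := by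
  have hl2 : (2 : ℝ) ≤ Real.exp 0.6931471808 := by
    have h1 := Real.exp_log (show (0:ℝ) < 2 by norm_num)
    have h2 := Real.exp_le_exp.mpr Real.log_two_lt_d9.le
    linarith
  have hsmall : (1.0001584576 : ℝ) ≤ Real.exp 0.0001584576 := by
    have := Real.add_one_le_exp (0.0001584576 : ℝ); linarith
  have hprod : Real.exp (2.0796 : ℝ) = Real.exp 0.6931471808 ^ 3 * Real.exp 0.0001584576 := by
    rw [← Real.exp_nat_mul, ← Real.exp_add]; norm_num
  rw [hprod]
  have h8 : (8 : ℝ) ≤ Real.exp 0.6931471808 ^ 3 := by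
    have := pow_le_pow_left₀ (by norm_num : (0:ℝ) ≤ 2) hl2 3
    linarith [show ((2 : ℝ)) ^ 3 = 8 by norm_num]
  nlinarith [mul_le_mul h8 hsmall (by norm_num) (by positivity)]

/-- `e^{2.7728} ≥ 16.00192 = 16·1.00012` (`2.7728 = 4·0.6931471808 + 0.0002112768`). [folklore] -/
private theorem exp_27728_ge : (16.00192 : ℝ) ≤ Real.exp 2.7728 := by
  have hl2 : (2 : ℝ) ≤ Real.exp 0.6931471808 := by
    have h1 := Real.exp_log (show (0:ℝ) < 2 by norm_num)
    have h2 := Real.exp_le_exp.mpr Real.log_two_lt_d9.le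
    linarith
  have hsmall : (1.0002112768 : ℝ) ≤ Real.exp 0.0002112768 := by
    have := Real.add_one_le_exp (0.0002112768 : ℝ); linarith
  have hprod : Real.exp (2.7728 : ℝ) = Real.exp 0.6931471808 ^ 4 * Real.exp 0.0002112768 := by
    rw [← Real.exp_nat_mul, ← Real.exp_add]; norm_num
  rw [hprod]
  have h16 : (16 : ℝ) ≤ Real.exp 0.6931471808 ^ 4 := by
    have := pow_le_pow_left₀ (by norm_num : (0:ℝ) ≤ 2) hl2 4
    linarith [show ((2 : ℝ)) ^ 4 = 16 by norm_num]
  nlinarith [mul_le_mul h16 hsmall (by norm_num) (by positivity)]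

set_option maxHeartbeats 1600000 in

/-- `TlowK2` is increasing on `[2, ∞)`. [folklore] -/
private theorem TlowK2_mono {l₁ l : ℝ} (h₁ : 2 ≤ l₁) (h : l₁ ≤ l) : TlowK2 l₁ ≤ TlowK2 l := by
  unfold TlowK2; nlinarith [h₁, h, mul_nonneg (sub_nonneg.2 h) (sub_nonneg.2 h₁), sq_nonneg (l - l₁)]

/-- `e^{1.3865} ≥ 4.00048 = 4·1.00012` (`1.3865 = 2·0.6931471808 + 0.0002056384`). [folklore] -/
private theorem exp_13865_ge : (4.00048 : ℝ) ≤ Real.exp 1.3865 := by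
  have hl2 : (2 : ℝ) ≤ Real.exp 0.6931471808 := by
    have h1 := Real.exp_log (show (0:ℝ) < 2 by norm_num)
    have h2 := Real.exp_le_exp.mpr Real.log_two_lt_d9.le
    linarith
  have hsmall : (1.0002056384 : ℝ) ≤ Real.exp 0.0002056384 := by
    have := Real.add_one_le_exp (0.0002056384 : ℝ); linarith
  have hprod : Real.exp (1.3865 : ℝ) = Real.exp 0.6931471808 ^ 2 * Real.exp 0.0002056384 := by
    rw [← Real.exp_nat_mul, ← Real.exp_add]; norm_num
  rw [hprod]
  have h4 : (4 : ℝ) ≤ Real.exp 0.6931471808 ^ 2 := by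
    have := pow_le_pow_left₀ (by norm_num : (0:ℝ) ≤ 2) hl2 2
    linarith [show ((2 : ℝ)) ^ 2 = 4 by norm_num]
  nlinarith [mul_le_mul h4 hsmall (by norm_num) (by positivity)]

set_option maxHeartbeats 1600000 in

/-- `2⁵⁷ ≤ e⁴⁰`. [folklore] -/
private theorem two_pow_57_le_exp_40 : (2 : ℝ) ^ 57 ≤ Real.exp 40 := by
  have he : (2.718281828 : ℝ) ≤ Real.exp 1 := by have := Real.exp_one_gt_d9; linarith
  have h := pow_le_pow_left₀ (by norm_num) he 40
  rw [← Real.exp_nat_mul] at h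
  norm_num at h
  exact le_trans (by norm_num) h

/-! ## §25 ROUND-41 «GAP-16»: the Hölder count with threshold gap `Λs + 16 ≤ Λ₀` (discard `0.0057 → 0.00005`),
the pair-sieve step re-instantiated from `e^38` and (on `TlowK3`) from `e^109`, `e^190`; RS glue from `L₁ = 38`:
under (3.3) `h = 19`, `K = 39` -/

/-! ### §25.1 The `J = 400` Hölder count with gap `16` -/

/-- `e^28 ≥ 10^12`. [folklore] -/
private theorem exp_28_ge : (1000000000000 : ℝ) ≤ Real.exp 28 := by
  have he : (2.718281828 : ℝ) ≤ Real.exp 1 := by have := Real.exp_one_gt_d9; linarith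
  have h := pow_le_pow_left₀ (by norm_num) he 28
  rw [← Real.exp_nat_mul] at h
  norm_num at h
  exact le_trans (by norm_num) h

set_option maxHeartbeats 1600000 in
/-- **Hölder with the `J = 400` staircase weight and threshold gap `Λs + 16 ≤ Λ₀`** (ROUND-41 «GAP-16»; ONE input of
`goldbach_even_count_ge_holder400` varied: the gap `12 → 16`, so the discard of `N < e^{Λs}` at the bottom level is
`(e^{Λs}+1)²·(Λ₀−4)²·e^{4−Λ₀} ≤ 1.0001²·158404·e^{−28}·x ≤ 2·10⁻⁷·x` and, with `21 + 2·10⁻⁷x ≤ 5·10⁻⁵x` for `x ≥ e^{13}`,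
`F = (c₁ − 10⁻⁴)·gHol4(Λ₀) − 0.00005` instead of `− 0.0057` (+0.58 %); everything else verbatim).
[cite: Nathanson1996, Thm 7.9 (Hölder step); RosserSchoenfeld1962 (not used here)] -/
theorem goldbach_even_count_ge_holder400g {Λs Λ₀ A c₁ κ : ℝ} (hΛs : 41 ≤ Λs) (h2Λ : Λs + 16 ≤ Λ₀)
    (hΛ₀ : 53.5 ≤ Λ₀) (hΛ₀4 : Λ₀ ≤ 400)
    (hA : 1 ≤ A)
    (hpt : ∀ N : ℕ, Real.exp Λs ≤ (N : ℝ) → Even N →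
      (SingularSeries.goldbachCount N : ℝ) ≤ A * oddSingularFactor N * (N : ℝ) / Real.log (N : ℝ) ^ 2)
    (hc₁ : 0.0001 ≤ c₁) (hc₁1 : c₁ ≤ 1)
    (hS₁ : ∀ y : ℕ, Real.exp Λs ≤ (y : ℝ) →
      c₁ * ((y : ℝ) ^ 2 / Real.log y ^ 2) ≤ ∑ N ∈ range (y + 1), (SingularSeries.goldbachCount N : ℝ))
    (hF0 : 0 ≤ (c₁ - 0.0001) * gHol4 Λ₀ - 0.00005)
    (hκ : κ ^ 7 * (259.55 * A ^ 8) ≤ ((c₁ - 0.0001) * gHol4 Λ₀ - 0.00005) ^ 8)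
    {x : ℕ} (hx : Real.exp Λ₀ ≤ (x : ℝ)) :
    κ * (x : ℝ) ≤ #{N ∈ Ioc 0 x | Even N ∧ ∃ p q : ℕ, p.Prime ∧ q.Prime ∧ p + q = N} := by
  -- basics
  have hx535 : Real.exp 53.5 ≤ (x : ℝ) := (Real.exp_le_exp.mpr hΛ₀).trans hx
  have hx1 : (1 : ℝ) < x := lt_of_lt_of_le (by have := Real.add_one_le_exp (53.5 : ℝ); linarith) hx535
  have hx0 : (0 : ℝ) < x := by linarith
  have hxN : 0 < x := by exact_mod_cast hx0
  set L := Real.log (x : ℝ) with hL_def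
  have hLΛ₀ : Λ₀ ≤ L := by
    have := Real.log_le_log (Real.exp_pos Λ₀) hx
    rwa [Real.log_exp] at this
  have hΛs0 : 0 < Λs := by linarith
  have hA0 : 0 ≤ A := by linarith
  -- the bottom level `ℓ_400 ≥ Λ₀ − 4 ≥ 49.5`
  have hℓ400 : Λ₀ - 4 ≤ stairL x 400 := by
    have := stairL_ge x 400
    push_cast at this
    linarith
  have hℓ495 : 49.5 ≤ stairL x 400 := by linarith
  have hℓ3 : 3 ≤ stairL x 400 := by linarith
  have ht400 : stairT x 400 = Real.exp (stairL x 400) := by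
    rw [← log_stairT hxN 400, Real.exp_log (stairT_pos hxN 400)]
  have hbotΛ : Real.exp Λs ≤ stairT x 400 := by rw [ht400]; exact Real.exp_le_exp.mpr (by linarith)
  have hbotS : Real.exp Λs + 1 ≤ stairT x 400 := by
    rw [ht400]
    have h1 : Real.exp (Λs + 1) ≤ Real.exp (stairL x 400) := Real.exp_le_exp.mpr (by linarith)
    have h2 : Real.exp (Λs + 1) = Real.exp Λs * Real.exp 1 := by rw [Real.exp_add]
    have h3 : (2 : ℝ) ≤ Real.exp 1 := by have := Real.add_one_le_exp (1 : ℝ); linarith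
    have h4 : (1 : ℝ) ≤ Real.exp Λs := by have := Real.add_one_le_exp Λs; linarith
    nlinarith [Real.exp_pos Λs]
  have hbot2 : (2 : ℝ) ≤ stairT x 400 := by
    have h4 : (1 : ℝ) ≤ Real.exp Λs := by have := Real.add_one_le_exp Λs; linarith
    linarith
  -- notation
  set r : ℕ → ℝ := fun N => (SingularSeries.goldbachCount N : ℝ) with hr
  set f : ℕ → ℝ := fun N => oddSingularFactor N with hf_def
  set m : ℕ → ℝ := stairW x 400 with hm
  have hm0 : ∀ N, 0 ≤ m N := fun N => stairW_nonneg hxN hℓ3 N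
  set c₁' := c₁ - 0.0001 with hc₁'
  have hc₁'0 : 0 ≤ c₁' := by rw [hc₁']; linarith
  have hc₁'1 : c₁' ≤ 1 := by rw [hc₁']; linarith
  set g := gHol4 Λ₀ with hg
  set F := c₁' * g - 0.00005 with hF_def
  set E : Finset ℕ := (range (x + 1)).filter Even with hE
  -- LOWER: `Σ_E r·m ≥ c₁'·(g·x − 21)`
  have hlower : c₁' * (g * x - 21) ≤ ∑ N ∈ E, r N * m N := by
    rw [hm, sum_mul_stairW x 400 E r]
    have hterm : ∀ j ∈ range 400, stairC x j * (c₁' * ((stairT x j - 1) ^ 2 / stairL x j ^ 2))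
        ≤ stairC x j * ∑ N ∈ E.filter (fun N : ℕ => (N : ℝ) ≤ stairT x j), r N := by
      intro j hj
      rw [mem_range] at hj
      apply mul_le_mul_of_nonneg_left _ (stairC_nonneg hxN hj hℓ3)
      rw [hE, hr]
      exact level_lower' hΛs hS₁ hc₁ hxN (hbotS.trans (stairT_le_of_le x hj.le))
    refine le_trans ?_ (sum_le_sum hterm)
    have e : ∑ j ∈ range 400, stairC x j * (c₁' * ((stairT x j - 1) ^ 2 / stairL x j ^ 2))
        = c₁' * ∑ j ∈ range 400, stairC x j * ((stairT x j - 1) ^ 2 / stairL x j ^ 2) := by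
      rw [mul_sum]
      exact sum_congr rfl fun j _ => by ring
    rw [e]
    exact mul_le_mul_of_nonneg_left (stair_lower_sum_ge400 hxN (by linarith) hLΛ₀ hbot2) hc₁'0
  -- the small `N < e^{Λs}`: `Σ r·m ≤ 2·10⁻⁷·x`
  set Ehi : Finset ℕ := E.filter (fun N : ℕ => Real.exp Λs ≤ (N : ℝ)) with hEhi
  set Elo : Finset ℕ := E.filter (fun N : ℕ => ¬(Real.exp Λs ≤ (N : ℝ))) with hElo
  have hsplit : ∑ N ∈ E, r N * m N = ∑ N ∈ Ehi, r N * m N + ∑ N ∈ Elo, r N * m N :=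
    (sum_filter_add_sum_filter_not E (fun N : ℕ => Real.exp Λs ≤ (N : ℝ)) (fun N => r N * m N)).symm
  have hMtop : stairMf x 400 ≤ (Λ₀ - 4) ^ 2 * Real.exp (-(Λ₀ - 4)) := by
    show stairM x 399 ≤ _
    unfold stairM
    have ht399 := stairT_pos hxN 399
    have h1 : stairL x (399 + 1) ^ 2 / stairT x 399 ≤ stairL x 400 ^ 2 / stairT x 400 :=
      div_le_div_of_nonneg_left (sq_nonneg _) (stairT_pos hxN 400) (stairT_le_of_le x (by norm_num))
    refine h1.trans ?_
    rw [ht400, div_le_iff₀ (Real.exp_pos _)]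
    have h2 := sq_le_sq_mul_exp (a := Λ₀ - 4) (by linarith) hℓ400
    have e : (Λ₀ - 4) ^ 2 * Real.exp (stairL x 400 - (Λ₀ - 4))
        = (Λ₀ - 4) ^ 2 * Real.exp (-(Λ₀ - 4)) * Real.exp (stairL x 400) := by
      rw [show stairL x 400 - (Λ₀ - 4) = -(Λ₀ - 4) + stairL x 400 by ring, Real.exp_add]; ring
    linarith [e]
  have hlo : ∑ N ∈ Elo, r N * m N ≤ 0.0000002 * x := by
    have hterm : ∀ N ∈ Elo, r N * m N ≤ (Real.exp Λs + 1) * ((Λ₀ - 4) ^ 2 * Real.exp (-(Λ₀ - 4))) := by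
      intro N hN
      rw [hElo, mem_filter] at hN
      have hNlt : (N : ℝ) < Real.exp Λs := not_le.mp hN.2
      have h1 : r N ≤ Real.exp Λs + 1 := by
        have : r N ≤ (N : ℝ) + 1 := by
          show (SingularSeries.goldbachCount N : ℝ) ≤ (N : ℝ) + 1
          exact_mod_cast goldbachCount_le_succ N
        linarith
      have h2 : m N ≤ (Λ₀ - 4) ^ 2 * Real.exp (-(Λ₀ - 4)) := (stairW_le_stairMf hxN hℓ3 N).trans hMtop
      have hr0 : 0 ≤ r N := Nat.cast_nonneg _
      exact mul_le_mul h1 h2 (hm0 N) (by positivity)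
    have hcard : (#Elo : ℝ) ≤ Real.exp Λs + 1 := by
      have hsub : Elo ⊆ range (⌊Real.exp Λs⌋₊ + 1) := by
        intro N hN
        rw [hElo, mem_filter] at hN
        have hNlt : (N : ℝ) < Real.exp Λs := not_le.mp hN.2
        rw [mem_range]
        have := Nat.le_floor hNlt.le
        omega
      have h1 := card_le_card hsub
      rw [card_range] at h1
      have h2 : (#Elo : ℝ) ≤ (⌊Real.exp Λs⌋₊ : ℝ) + 1 := by exact_mod_cast h1
      have h3 : (⌊Real.exp Λs⌋₊ : ℝ) ≤ Real.exp Λs := Nat.floor_le (Real.exp_pos Λs).le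
      linarith
    have hs := sum_le_sum hterm
    rw [sum_const, nsmul_eq_mul] at hs
    refine hs.trans ?_
    -- `(e^Λs + 1)² · (Λ₀−4)² · e^{4−Λ₀} ≤ 2·10⁻⁷·x` from `Λs + 16 ≤ Λ₀ ≤ 400` and `e^{Λ₀} ≤ x`
    have heΛ' : Real.exp Λs + 1 ≤ 1.0001 * Real.exp Λs := by
      have : (10000 : ℝ) ≤ Real.exp Λs := by
        have h13 := exp_13_ge
        have : Real.exp 13 ≤ Real.exp Λs := Real.exp_le_exp.mpr (by linarith)
        linarith
      linarith
    have hpos1 : 0 ≤ Real.exp Λs + 1 := by positivity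
    have hx18 : Real.exp (2 * Λs) * Real.exp (-(Λ₀ - 4)) ≤ Real.exp (-28) * x := by
      have e1 : Real.exp (2 * Λs) * Real.exp (-(Λ₀ - 4)) = Real.exp (2 * Λs + -(Λ₀ - 4)) := by
        rw [← Real.exp_add]
      have e2 : Real.exp (2 * Λs + -(Λ₀ - 4)) ≤ Real.exp (-28 + Λ₀) := Real.exp_le_exp.mpr (by linarith)
      have e3 : Real.exp (-28 + Λ₀) = Real.exp (-28) * Real.exp Λ₀ := Real.exp_add _ _
      rw [e1]
      refine e2.trans ?_
      rw [e3]
      exact mul_le_mul_of_nonneg_left hx (Real.exp_pos _).le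
    have h18 : Real.exp (-28) ≤ 1 / 1000000000000 := by
      rw [Real.exp_neg, one_div]
      exact inv_anti₀ (by norm_num) exp_28_ge
    have hΛsq : (Λ₀ - 4) ^ 2 ≤ 158404 := by nlinarith [hΛ₀4, hΛ₀]
    have e2Λ : Real.exp Λs * Real.exp Λs = Real.exp (2 * Λs) := by rw [← Real.exp_add]; ring_nf
    calc (#Elo : ℝ) * ((Real.exp Λs + 1) * ((Λ₀ - 4) ^ 2 * Real.exp (-(Λ₀ - 4))))
        ≤ (Real.exp Λs + 1) * ((Real.exp Λs + 1) * ((Λ₀ - 4) ^ 2 * Real.exp (-(Λ₀ - 4)))) :=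
          mul_le_mul_of_nonneg_right hcard (by positivity)
      _ ≤ (1.0001 * Real.exp Λs) * ((1.0001 * Real.exp Λs) * ((Λ₀ - 4) ^ 2 * Real.exp (-(Λ₀ - 4)))) :=
          mul_le_mul heΛ' (mul_le_mul_of_nonneg_right heΛ' (by positivity)) (by positivity) (by positivity)
      _ = 1.0001 ^ 2 * ((Λ₀ - 4) ^ 2 * (Real.exp (2 * Λs) * Real.exp (-(Λ₀ - 4)))) := by rw [← e2Λ]; ring
      _ ≤ 1.0001 ^ 2 * ((Λ₀ - 4) ^ 2 * (Real.exp (-28) * x)) :=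
          mul_le_mul_of_nonneg_left (mul_le_mul_of_nonneg_left hx18 (sq_nonneg _)) (by norm_num)
      _ ≤ 1.0001 ^ 2 * (158404 * ((1 / 1000000000000) * x)) :=
          mul_le_mul_of_nonneg_left (mul_le_mul hΛsq (mul_le_mul_of_nonneg_right h18 hx0.le)
            (by positivity) (by norm_num)) (by norm_num)
      _ ≤ 0.0000002 * x := by nlinarith
  -- UPPER, pointwise on `T = {N ∈ Ehi : r(N) > 0}`: `r·m ≤ A·f`
  set T : Finset ℕ := Ehi.filter fun N => 0 < SingularSeries.goldbachCount N with hT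
  have hpoint : ∀ N ∈ T, r N * m N ≤ A * f N := by
    intro N hN
    rw [hT, mem_filter, hEhi, mem_filter, hE, mem_filter, mem_range] at hN
    obtain ⟨⟨⟨hNx, hev⟩, hNΛ⟩, _⟩ := hN
    have hNx' : (N : ℝ) ≤ x := by exact_mod_cast Nat.lt_succ_iff.mp hNx
    by_cases hQ : stairT x 400 < (N : ℝ)
    · exact stair_rm_le_main400 hxN hΛs0 hA0 hpt hbotΛ hev hNx' hQ
    · exact stair_rm_le_bottom400 hxN (by linarith) hA0 hpt hev hNΛ (not_lt.mp hQ)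
  have hsumT : ∑ N ∈ Ehi, r N * m N = ∑ N ∈ T, r N * m N := by
    have h := Finset.sum_filter_of_ne (s := Ehi) (f := fun N => r N * m N)
      (p := fun N => 0 < SingularSeries.goldbachCount N) (fun N _ hne => by
        by_contra h0
        apply hne
        simp only [not_lt, Nat.le_zero] at h0
        simp [hr, h0])
    rw [hT, h]
  have hupper : ∑ N ∈ T, r N * m N ≤ A * ∑ N ∈ T, f N := by
    rw [mul_sum]
    exact sum_le_sum hpoint
  -- `F·x ≤ A·Σ_T f`
  have hx21 : (21 : ℝ) + 0.0000002 * x ≤ 0.00005 * x + 0 := by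
    have : (442000 : ℝ) ≤ x := by
      have h13 := exp_13_ge
      have : Real.exp 13 ≤ Real.exp 53.5 := Real.exp_le_exp.mpr (by norm_num)
      linarith
    linarith
  have hFx : F * x ≤ A * ∑ N ∈ T, f N := by
    have h1 : c₁' * (g * x - 21) - 0.0000002 * x ≤ ∑ N ∈ T, r N * m N := by
      rw [← hsumT]; linarith [hsplit, hlower, hlo]
    have h2 : F * x ≤ c₁' * (g * x - 21) - 0.0000002 * x := by
      rw [hF_def]
      have : c₁' * 21 ≤ 21 := by nlinarith
      nlinarith
    exact h2.trans (h1.trans hupper)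
  -- Hölder on `T`
  set Ep : Finset ℕ := (Ioc 0 x).filter Even with hEp
  have hTA : T ⊆ {N ∈ Ioc 0 x | Even N ∧ ∃ p q : ℕ, p.Prime ∧ q.Prime ∧ p + q = N} := by
    intro N hN
    rw [hT, mem_filter, hEhi, mem_filter, hE, mem_filter, mem_range] at hN
    obtain ⟨⟨⟨hNx, he⟩, _⟩, hpos⟩ := hN
    unfold SingularSeries.goldbachCount at hpos
    obtain ⟨pq, hpq⟩ := card_pos.mp hpos
    rw [mem_filter, Finset.HasAntidiagonal.mem_antidiagonal] at hpq
    have hN2 : 2 ≤ N := by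
      have := hpq.2.1.two_le
      omega
    rw [mem_filter, mem_Ioc]
    exact ⟨⟨by omega, by omega⟩, he, pq.1, pq.2, hpq.2.1, hpq.2.2, hpq.1⟩
  have hTEp : T ⊆ Ep := by
    intro N hN
    have h := hTA hN
    rw [mem_filter] at h
    rw [hEp, mem_filter]
    exact ⟨h.1, h.2.1⟩
  have hf0 : ∀ N ∈ T, 0 ≤ f N := fun N _ => oddSingularFactor_nonneg N
  have hHolder : (∑ N ∈ T, f N) ^ 8 ≤ (#T : ℝ) ^ 7 * (259.55 * x) := by
    have h1 := pow8_sum_le T f hf0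
    have h2 : ∑ N ∈ T, f N ^ 8 ≤ 259.55 * x :=
      (sum_le_sum_of_subset_of_nonneg hTEp fun N _ _ => by positivity).trans
        (sum_even_oddSingularFactor_pow8_le x)
    exact h1.trans (mul_le_mul_of_nonneg_left h2 (by positivity))
  set Ax : ℝ := ((#{N ∈ Ioc 0 x | Even N ∧ ∃ p q : ℕ, p.Prime ∧ q.Prime ∧ p + q = N} : ℕ) : ℝ) with hAx
  have hTcard : (#T : ℝ) ≤ Ax := by rw [hAx]; exact_mod_cast card_le_card hTA
  -- the final algebra: `(F x)⁸ ≤ A⁸·|T|⁷·259.55·x` and `κ⁷·259.55·A⁸ ≤ F⁸` give `|T| ≥ κ·x`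
  have hF0' : 0 ≤ F := hF0
  have hFx0 : 0 ≤ F * x := mul_nonneg hF0' hx0.le
  have hchain : (F * x) ^ 8 ≤ A ^ 8 * ((#T : ℝ) ^ 7 * (259.55 * x)) := by
    calc (F * x) ^ 8 ≤ (A * ∑ N ∈ T, f N) ^ 8 := pow_le_pow_left₀ hFx0 hFx 8
      _ = A ^ 8 * (∑ N ∈ T, f N) ^ 8 := by ring
      _ ≤ A ^ 8 * ((#T : ℝ) ^ 7 * (259.55 * x)) := mul_le_mul_of_nonneg_left hHolder (by positivity)
  by_contra hcon
  rw [not_le] at hcon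
  have hTlt : (#T : ℝ) < κ * x := lt_of_le_of_lt hTcard hcon
  have h7 : (#T : ℝ) ^ 7 < (κ * x) ^ 7 := pow_lt_pow_left₀ hTlt (by positivity) (by norm_num)
  have hlt : A ^ 8 * ((#T : ℝ) ^ 7 * (259.55 * x)) < A ^ 8 * ((κ * x) ^ 7 * (259.55 * x)) := by
    apply mul_lt_mul_of_pos_left _ (by positivity)
    exact mul_lt_mul_of_pos_right h7 (by positivity)
  have e1 : A ^ 8 * ((κ * x) ^ 7 * (259.55 * x)) = κ ^ 7 * (259.55 * A ^ 8) * (x : ℝ) ^ 8 := by ring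
  have e2 : (F * x) ^ 8 = F ^ 8 * (x : ℝ) ^ 8 := by ring
  have hκx : κ ^ 7 * (259.55 * A ^ 8) * (x : ℝ) ^ 8 ≤ F ^ 8 * (x : ℝ) ^ 8 :=
    mul_le_mul_of_nonneg_right hκ (by positivity)
  linarith [hchain, hlt, e1, e2, hκx]


/-! ### §25.2 The pair-sieve step from `e^38` (`c ≤ 16`, `TlowK2`) -/

/-- `2^54 ≤ e^38` as a numeral (`e ≥ 2.718281828`). [folklore] -/
private theorem numeral_le_exp_38 : (18014398509481984 : ℝ) ≤ Real.exp 38 := by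
  have he : (2.718281828 : ℝ) ≤ Real.exp 1 := by have := Real.exp_one_gt_d9; linarith
  have h := pow_le_pow_left₀ (by norm_num) he 38
  rw [← Real.exp_nat_mul] at h
  norm_num at h
  exact le_trans (by norm_num) h

/-- The boundary numerics from `L ≥ 38`: `(E/4 + 1)·L² ≤ 0.01·E²` once `100 L² ≤ E`. [folklore] -/
private theorem tail_numeric38 {L E : ℝ} (hL : 38 ≤ L) (hEL : 100 * L ^ 2 ≤ E) :
    (E / 4 + 1) * L ^ 2 ≤ 0.01 * E ^ 2 := by
  have hL2 : (1444 : ℝ) ≤ L ^ 2 := by nlinarith [hL]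
  have hE : (144400 : ℝ) ≤ E := by linarith
  nlinarith [hEL, hE, hL2]

/-- `TlowK2(l₁) ≥ 88` for `l₁ ≥ 17.6`. [folklore] -/
private theorem TlowK2_ge'' {l₁ : ℝ} (h₁ : 17.6 ≤ l₁) : 88 ≤ TlowK2 l₁ := by
  unfold TlowK2; nlinarith [h₁, sq_nonneg (l₁ - 17.6)]

set_option maxHeartbeats 1600000 in
/-- **The enlarged-cell explicit large-sieve step from `e^38`** (ROUND-41; as `explicit_of_largeSieve_kappa2_c40` with
`Λ ≥ max(38, 35.2 + 2·lc)` and `c ≤ 16`: `√N ≥ (L/2)^12/12! ≥ 4.6·10^6 ≥ 16·262145` at `L ≥ 38`, `TlowK2(l₁) ≥ 88` for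
`l₁ ≥ 17.6` (only positivity is used), and the boundary numerics from `L ≥ 38`).
[cite: BatemanDiamond2004, Thm 13.8, §13.4–13.5 pp. 325–328 (explicit form proved here)] -/

theorem explicit_of_largeSieve_kappa2_c38 {c : ℕ} {lc Λ A : ℝ} (hc4 : 4 ≤ c) (hc16 : c ≤ 16)
    (hlc : (c : ℝ) * 1.00012 ≤ Real.exp lc) (hΛ : 38 ≤ Λ) (hΛc : 35.2 + 2 * lc ≤ Λ)
    (hA : ∀ L : ℝ, Λ ≤ L → ((c : ℝ) ^ 2 + 1) * L ^ 2
        ≤ (c : ℝ) ^ 2 * (A - 0.02) * TlowK2 (L / 2 - lc))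
    {N : ℕ} {C F B : ℝ} (hN : Real.exp Λ ≤ (N : ℝ)) (hF1 : 1 ≤ F)
    (hB : B ≤ 2 * ((Nat.sqrt N / c : ℕ) : ℝ) + 2)
    (hBD : C * GoldbachSieveEight.Qsum ∅ (Nat.sqrt N / c) ≤ (((Nat.sqrt N / c : ℕ) : ℝ) ^ 2 + N - 1) * F
      + B * GoldbachSieveEight.Qsum ∅ (Nat.sqrt N / c)) :
    C ≤ A * F * (N : ℝ) / Real.log (N : ℝ) ^ 2 := by
  have hN0 : (0 : ℝ) < N := lt_of_lt_of_le (Real.exp_pos Λ) hN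
  set L := Real.log (N : ℝ) with hLdef
  have hL : Λ ≤ L := by
    have := Real.log_le_log (Real.exp_pos Λ) hN
    rwa [Real.log_exp] at this
  have hL40 : (38 : ℝ) ≤ L := le_trans hΛ hL
  have hL2pos : 0 < L ^ 2 := by positivity
  have hcpos : 0 < c := by omega
  have hc0 : (0 : ℝ) < c := by exact_mod_cast hcpos
  have hcR4 : (4 : ℝ) ≤ c := by exact_mod_cast hc4
  have hcR32 : (c : ℝ) ≤ 16 := by exact_mod_cast hc16
  -- E = √N = exp(L/2)
  set E := Real.exp (L / 2) with hEdef
  have hE0 : 0 < E := Real.exp_pos _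
  have hE2 : E ^ 2 = N := by
    have : E ^ 2 = Real.exp L := by rw [hEdef, sq, ← Real.exp_add]; ring_nf
    rw [this, hLdef, Real.exp_log hN0]
  have hE8 : (L / 2) ^ 8 / 40320 ≤ E := by
    have := Real.pow_div_factorial_le_exp (L / 2) (by linarith) 8
    simpa [Nat.factorial] using this
  have hLsq : (1444 : ℝ) ≤ L ^ 2 := by nlinarith [hL40]
  have hL4 : (1444 : ℝ) ^ 2 ≤ (L ^ 2) ^ 2 := pow_le_pow_left₀ (by norm_num) hLsq 2
  have hEL : 100 * L ^ 2 ≤ E := by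
    have h1 : (1444 : ℝ) ^ 2 * 1444 * L ^ 2 ≤ (L ^ 2) ^ 2 * L ^ 2 * L ^ 2 := by
      have := mul_le_mul hL4 hLsq (by norm_num) (by positivity)
      nlinarith [this, hL2pos]
    have h2 : (L / 2) ^ 8 / 40320 = (L ^ 2) ^ 2 * L ^ 2 * L ^ 2 / 10321920 := by ring
    rw [h2] at hE8
    nlinarith [h1, hE8]
  have hE12 : (L / 2) ^ 12 / 479001600 ≤ E := by
    have := Real.pow_div_factorial_le_exp (L / 2) (by linarith) 12
    simpa [Nat.factorial] using this
  have hEbig2 : (4600000 : ℝ) ≤ E := by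
    have h1 : ((19 : ℝ)) ^ 12 ≤ (L / 2) ^ 12 := pow_le_pow_left₀ (by norm_num) (by linarith) 12
    have h2 : ((19 : ℝ)) ^ 12 / 479001600 ≤ E := le_trans (div_le_div_of_nonneg_right h1 (by norm_num)) hE12
    norm_num at h2
    linarith
  -- s = ⌊√N⌋, X = s / c
  set s := Nat.sqrt N with hsdef
  set X := s / c with hXdef
  have hs2 : (s : ℝ) ^ 2 ≤ N := by exact_mod_cast Nat.sqrt_le' N
  have hs2' : (N : ℝ) < ((s : ℝ) + 1) ^ 2 := by exact_mod_cast Nat.lt_succ_sqrt' N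
  have hsE : (s : ℝ) ≤ E := by
    have : (s : ℝ) ^ 2 ≤ E ^ 2 := by rw [hE2]; exact hs2
    exact (pow_le_pow_iff_left₀ (Nat.cast_nonneg s) hE0.le two_ne_zero).mp this
  have hEs : E < (s : ℝ) + 1 := by
    have : E ^ 2 < ((s : ℝ) + 1) ^ 2 := by rw [hE2]; exact hs2'
    exact (pow_lt_pow_iff_left₀ hE0.le (by positivity) two_ne_zero).mp this
  have hXc : X * c ≤ s := Nat.div_mul_le_self s c
  have hXc' : s + 1 ≤ X * c + c := Nat.lt_div_mul_add hcpos
  have hXcR : (X : ℝ) * c ≤ s := by exact_mod_cast hXc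
  have hXcR' : (s : ℝ) + 1 ≤ (X : ℝ) * c + c := by exact_mod_cast hXc'
  have hX0R : (0 : ℝ) ≤ X := Nat.cast_nonneg X
  have hXR : (X : ℝ) ^ 2 * (c : ℝ) ^ 2 ≤ (N : ℝ) := by
    have : ((X : ℝ) * c) ^ 2 ≤ (s : ℝ) ^ 2 := pow_le_pow_left₀ (by positivity) hXcR 2
    nlinarith [hs2, this]
  have hXlo : E / c - 1 < (X : ℝ) := by
    have h1 : E < (X : ℝ) * c + c := by linarith [hEs, hXcR']
    rw [sub_lt_iff_lt_add, div_lt_iff₀ hc0]; linarith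
  have hXhi : (X : ℝ) ≤ E / c := by
    rw [le_div_iff₀ hc0]; linarith [hsE, hXcR]
  have hEc : (262145 : ℝ) ≤ E / c := by
    rw [le_div_iff₀ hc0]; nlinarith [hEbig2, hcR32]
  have hX0 : (0 : ℝ) < X := by linarith
  have hX262144 : 262144 ≤ X := by
    have : (262144 : ℝ) ≤ X := by linarith
    exact_mod_cast this
  -- log X ≥ l₁ := L/2 − lc
  set l₁ := L / 2 - lc with hl₁def
  have hexp : Real.exp l₁ ≤ (X : ℝ) := by
    rw [hl₁def, Real.exp_sub]
    have hlc0 : (0 : ℝ) < (c : ℝ) * 1.00012 := by positivity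
    have h1 : E / Real.exp lc ≤ E / ((c : ℝ) * 1.00012) :=
      div_le_div_of_nonneg_left hE0.le hlc0 hlc
    have h2 : E / ((c : ℝ) * 1.00012) ≤ E / c - 1 := by
      rw [show E / ((c : ℝ) * 1.00012) = E / c / 1.00012 by rw [div_div],
        div_le_iff₀ (by norm_num : (0 : ℝ) < 1.00012)]
      linarith [hEc]
    linarith [hXlo]
  have hl : l₁ ≤ Real.log X := by
    rw [Real.le_log_iff_exp_le hX0]; exact hexp
  have hl₁ : (17.6 : ℝ) ≤ l₁ := by rw [hl₁def]; linarith
  -- Q ≥ TlowK2(log X) ≥ TlowK2(l₁) ≥ 99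
  set Q := GoldbachSieveEight.Qsum ∅ X with hQdef
  have hQ : TlowK2 (Real.log X) ≤ Q := Qsum_ge_kappa2 hX262144
  have hQT : TlowK2 l₁ ≤ Q := le_trans (TlowK2_mono (by linarith) hl) hQ
  have hT₁ : (88 : ℝ) ≤ TlowK2 l₁ := TlowK2_ge'' hl₁
  have hQpos : 0 < Q := by linarith
  have hF0 : 0 ≤ F := le_trans zero_le_one hF1
  have hC1 : C ≤ ((X : ℝ) ^ 2 + N - 1) * F / Q + B := by
    have : C * Q ≤ (((X : ℝ) ^ 2 + N - 1) * F / Q + B) * Q := by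
      rw [add_mul, div_mul_cancel₀ _ hQpos.ne']
      exact hBD
    exact le_of_mul_le_mul_right this hQpos
  have hc2pos : (0 : ℝ) < (c : ℝ) ^ 2 := by positivity
  set K : ℝ := ((c : ℝ) ^ 2 + 1) / (c : ℝ) ^ 2 with hKdef
  have hK0 : 0 < K := by positivity
  have hC2 : ((X : ℝ) ^ 2 + N - 1) * F / Q ≤ K * (N : ℝ) * F / TlowK2 l₁ := by
    have hnum0 : 0 ≤ K * (N : ℝ) * F := by positivity
    have hXN : (X : ℝ) ^ 2 ≤ (N : ℝ) / (c : ℝ) ^ 2 := by rw [le_div_iff₀ hc2pos]; exact hXR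
    have hKN : (X : ℝ) ^ 2 + N - 1 ≤ K * N := by
      have : K * N = N / (c : ℝ) ^ 2 + N := by rw [hKdef]; field_simp; ring
      rw [this]; linarith
    have hnum : ((X : ℝ) ^ 2 + N - 1) * F ≤ K * (N : ℝ) * F := mul_le_mul_of_nonneg_right hKN hF0
    calc ((X : ℝ) ^ 2 + N - 1) * F / Q ≤ K * (N : ℝ) * F / Q := div_le_div_of_nonneg_right hnum hQpos.le
      _ ≤ K * (N : ℝ) * F / TlowK2 l₁ :=
          div_le_div_of_nonneg_left hnum0 (by linarith) hQT
  -- main term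
  have hmain : K * (N : ℝ) * F / TlowK2 l₁ ≤ (A - 0.02) * F * (N : ℝ) / L ^ 2 := by
    have hkey : ((c : ℝ) ^ 2 + 1) * L ^ 2 ≤ (c : ℝ) ^ 2 * (A - 0.02) * TlowK2 l₁ := hA L hL
    have hkey' : K * L ^ 2 ≤ (A - 0.02) * TlowK2 l₁ := by
      rw [hKdef, div_mul_eq_mul_div, div_le_iff₀ hc2pos]
      linarith [hkey]
    rw [div_le_div_iff₀ (by linarith) hL2pos]
    have hNF : 0 ≤ (N : ℝ) * F := by positivity
    have h := mul_le_mul_of_nonneg_left hkey' hNF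
    calc K * (N : ℝ) * F * L ^ 2 = (N : ℝ) * F * (K * L ^ 2) := by ring
      _ ≤ (N : ℝ) * F * ((A - 0.02) * TlowK2 l₁) := h
      _ = (A - 0.02) * F * (N : ℝ) * TlowK2 l₁ := by ring
  -- boundary term
  have htail : B ≤ 0.02 * F * (N : ℝ) / L ^ 2 := by
    have h2 : (E / 4 + 1) * L ^ 2 ≤ 0.01 * (N : ℝ) := by
      rw [← hE2]; exact tail_numeric38 hL40 hEL
    have h3 : 0.02 * (N : ℝ) ≤ 0.02 * F * (N : ℝ) :=
      calc 0.02 * (N : ℝ) ≤ F * (0.02 * (N : ℝ)) := le_mul_of_one_le_left (by positivity) hF1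
        _ = 0.02 * F * (N : ℝ) := by ring
    rw [le_div_iff₀ hL2pos]
    have h1 : B * L ^ 2 ≤ 2 * ((E / 4 + 1) * L ^ 2) := by
      have hEc4 : E / c ≤ E / 4 := div_le_div_of_nonneg_left hE0.le (by norm_num) hcR4
      have : B ≤ 2 * (E / 4 + 1) := by linarith only [hB, hXhi, hEc4]
      nlinarith only [this, hL2pos]
    linarith only [h1, h2, h3]
  calc C ≤ ((X : ℝ) ^ 2 + N - 1) * F / Q + B := hC1
    _ ≤ K * (N : ℝ) * F / TlowK2 l₁ + B := by linarith only [hC2]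
    _ ≤ (A - 0.02) * F * (N : ℝ) / L ^ 2 + 0.02 * F * (N : ℝ) / L ^ 2 := add_le_add hmain htail
    _ = A * F * (N : ℝ) / L ^ 2 := by ring


/-- **Explicit PRIME-PAIR sieve bound with length `⌊√N⌋/c`, from `e^38`**: under the numerics of
`explicit_of_largeSieve_kappa2_c38`, `#{p ≤ N : p + h prime} ≤ A·f(h)·N/log²N` for even `h ≠ 0`, `N ≥ e^Λ`.
[cite: BatemanDiamond2004, Thm 13.8 (explicit form proved here)] -/

theorem pairCount_le_of_numeric2_c38 {c : ℕ} {lc Λ A : ℝ} (hc4 : 4 ≤ c) (hc16 : c ≤ 16)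
    (hlc : (c : ℝ) * 1.00012 ≤ Real.exp lc) (hΛ : 38 ≤ Λ) (hΛc : 35.2 + 2 * lc ≤ Λ)
    (hA : ∀ L : ℝ, Λ ≤ L → ((c : ℝ) ^ 2 + 1) * L ^ 2
        ≤ (c : ℝ) ^ 2 * (A - 0.02) * TlowK2 (L / 2 - lc))
    {N h : ℕ} (hN : Real.exp Λ ≤ (N : ℝ)) (hh : h ≠ 0) (heven : Even h) :
    ((((Nat.primesLE N).filter fun p => (p + h).Prime).card : ℕ) : ℝ)
      ≤ A * oddSingularFactor h * (N : ℝ) / Real.log (N : ℝ) ^ 2 := by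
  have h40 : Real.exp 38 ≤ (N : ℝ) := (Real.exp_le_exp.mpr hΛ).trans hN
  have h20 : (2 : ℝ) ^ 20 ≤ (N : ℝ) := le_trans (by norm_num) (numeral_le_exp_38.trans h40)
  have hX1 : 1 ≤ Nat.sqrt N / c := by
    have h20' : 2 ^ 20 ≤ N := by exact_mod_cast h20
    have hs : 1024 ≤ Nat.sqrt N := by
      rw [Nat.le_sqrt]
      calc 1024 * 1024 = 2 ^ 20 := by norm_num
        _ ≤ N := h20'
    exact (Nat.le_div_iff_mul_le (by omega)).mpr (by omega)
  have hBD := GoldbachSieveEight.card_primePairs_mul_Qsum_le 1 h N (Nat.sqrt N / c) le_rfl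
    (Nat.one_le_iff_ne_zero.mpr hh) (by simpa using heven) hX1
  have hprod : (∏ p ∈ ((1 * h).primeFactors.filter (2 < ·)), (((p : ℝ) - 1) / ((p : ℝ) - 2)))
      = oddSingularFactor h := by rw [one_mul]; rfl
  rw [hprod] at hBD
  have hmain := explicit_of_largeSieve_kappa2_c38 hc4 hc16 hlc hΛ hΛc hA hN
    (one_le_oddSingularFactor' _) (by linarith) hBD
  have hcount : ((range (N + 1)).filter (fun p => p.Prime ∧ (1 * p + h).Prime)).card
      = ((Nat.primesLE N).filter fun p => (p + h).Prime).card := by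
    congr 1
    ext p
    simp only [mem_filter, mem_range, Nat.mem_primesLE, one_mul, Nat.lt_succ_iff]
    tauto
  rw [hcount] at hmain
  exact hmain


/-- `c = 4` numerics at `Λ = 38`: `17L² ≤ 16·17.43·TlowK2(L/2 − 1.3865)` for `L ≥ 38`. [folklore] -/
private theorem cells4_numeric_38 {L : ℝ} (hL : 38 ≤ L) :
    (((4 : ℕ) : ℝ) ^ 2 + 1) * L ^ 2 ≤ ((4 : ℕ) : ℝ) ^ 2 * (17.45 - 0.02) * TlowK2 (L / 2 - 1.3865) := by
  unfold TlowK2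
  push_cast
  nlinarith [hL, mul_self_nonneg (L - 38)]

/-- **PAIR SIEVE `17.45` above `e^38`** (`c = 4`, 25 cells, the `e^38` sieve step).
[cite: BatemanDiamond2004, Thm 13.8, §13.4–13.5 pp. 325–328 (explicit form proved here)] -/
theorem pairCount_le_1745 {N h : ℕ} (hN : Real.exp 38 ≤ (N : ℝ)) (hh : h ≠ 0) (heven : Even h) :
    ((((Nat.primesLE N).filter fun p => (p + h).Prime).card : ℕ) : ℝ)
      ≤ 17.45 * oddSingularFactor h * (N : ℝ) / Real.log (N : ℝ) ^ 2 :=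
  pairCount_le_of_numeric2_c38 (c := 4) (lc := 1.3865) (by norm_num) (by norm_num)
    (by have := exp_13865_ge; push_cast; linarith) (by norm_num) (by norm_num)
    (fun _ hL => cells4_numeric_38 hL) hN hh heven

/-! ### §25.3 Pair sieves on the 68 cells (`TlowK3`, `c = 8`): `13.06` from `e^109`, `12.19` from `e^190` -/

/-- **Explicit PRIME-PAIR sieve bound with length `⌊√N⌋/c` on `TlowK3`**: under the numerics of
`explicit_of_largeSieve_kappa3_c`, `#{p ≤ N : p + h prime} ≤ A·f(h)·N/log²N` for even `h ≠ 0`, `N ≥ e^Λ`.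
[cite: BatemanDiamond2004, Thm 13.8 (explicit form proved here)] -/

theorem pairCount_le_of_numeric3_c {c : ℕ} {lc Λ A : ℝ} (hc4 : 4 ≤ c) (hc40 : c ≤ 40)
    (hlc : (c : ℝ) * 1.00012 ≤ Real.exp lc) (hΛ : 60 ≤ Λ) (hΛc : 38.22 + 2 * lc ≤ Λ)
    (hA : ∀ L : ℝ, Λ ≤ L → ((c : ℝ) ^ 2 + 1) * L ^ 2
        ≤ (c : ℝ) ^ 2 * (A - 0.02) * TlowK3 (L / 2 - lc))
    {N h : ℕ} (hN : Real.exp Λ ≤ (N : ℝ)) (hh : h ≠ 0) (heven : Even h) :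
    ((((Nat.primesLE N).filter fun p => (p + h).Prime).card : ℕ) : ℝ)
      ≤ A * oddSingularFactor h * (N : ℝ) / Real.log (N : ℝ) ^ 2 := by
  have h40 : Real.exp 40 ≤ (N : ℝ) := (Real.exp_le_exp.mpr (le_trans (by norm_num) hΛ)).trans hN
  have h20 : (2 : ℝ) ^ 20 ≤ (N : ℝ) := le_trans (by norm_num) (two_pow_57_le_exp_40.trans h40)
  have hX1 : 1 ≤ Nat.sqrt N / c := by
    have h20' : 2 ^ 20 ≤ N := by exact_mod_cast h20
    have hs : 1024 ≤ Nat.sqrt N := by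
      rw [Nat.le_sqrt]
      calc 1024 * 1024 = 2 ^ 20 := by norm_num
        _ ≤ N := h20'
    exact (Nat.le_div_iff_mul_le (by omega)).mpr (by omega)
  have hBD := GoldbachSieveEight.card_primePairs_mul_Qsum_le 1 h N (Nat.sqrt N / c) le_rfl
    (Nat.one_le_iff_ne_zero.mpr hh) (by simpa using heven) hX1
  have hprod : (∏ p ∈ ((1 * h).primeFactors.filter (2 < ·)), (((p : ℝ) - 1) / ((p : ℝ) - 2)))
      = oddSingularFactor h := by rw [one_mul]; rfl
  rw [hprod] at hBD
  have hmain := explicit_of_largeSieve_kappa3_c hc4 hc40 hlc hΛ hΛc hA hN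
    (one_le_oddSingularFactor' _) (by linarith) hBD
  have hcount : ((range (N + 1)).filter (fun p => p.Prime ∧ (1 * p + h).Prime)).card
      = ((Nat.primesLE N).filter fun p => (p + h).Prime).card := by
    congr 1
    ext p
    simp only [mem_filter, mem_range, Nat.mem_primesLE, one_mul, Nat.lt_succ_iff]
    tauto
  rw [hcount] at hmain
  exact hmain


/-- `c = 8` numerics at `Λ = 109` on `TlowK3`: `65L² ≤ 64·13.04·TlowK3(L/2 − 2.0796)` for `L ≥ 109`. [folklore] -/
private theorem cells8_numeric3_109 {L : ℝ} (hL : 109 ≤ L) :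
    (((8 : ℕ) : ℝ) ^ 2 + 1) * L ^ 2 ≤ ((8 : ℕ) : ℝ) ^ 2 * (13.06 - 0.02) * TlowK3 (L / 2 - 2.0796) := by
  unfold TlowK3
  push_cast
  nlinarith [hL, mul_self_nonneg (L - 109)]

/-- `c = 8` numerics at `Λ = 190` on `TlowK3`: `65L² ≤ 64·12.17·TlowK3(L/2 − 2.0796)` for `L ≥ 190`. [folklore] -/
private theorem cells8_numeric3_190 {L : ℝ} (hL : 190 ≤ L) :
    (((8 : ℕ) : ℝ) ^ 2 + 1) * L ^ 2 ≤ ((8 : ℕ) : ℝ) ^ 2 * (12.19 - 0.02) * TlowK3 (L / 2 - 2.0796) := by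
  unfold TlowK3
  push_cast
  nlinarith [hL, mul_self_nonneg (L - 190)]

/-- **PAIR SIEVE `13.06` above `e^109`** (`c = 8`, 68 cells). [cite: BatemanDiamond2004, Thm 13.8, §13.4–13.5 pp. 325–328 (explicit form proved here)] -/
theorem pairCount_le_1306 {N h : ℕ} (hN : Real.exp 109 ≤ (N : ℝ)) (hh : h ≠ 0) (heven : Even h) :
    ((((Nat.primesLE N).filter fun p => (p + h).Prime).card : ℕ) : ℝ)
      ≤ 13.06 * oddSingularFactor h * (N : ℝ) / Real.log (N : ℝ) ^ 2 :=
  pairCount_le_of_numeric3_c (c := 8) (lc := 2.0796) (by norm_num) (by norm_num)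
    (by have := exp_20796_ge; push_cast; linarith) (by norm_num) (by norm_num)
    (fun _ hL => cells8_numeric3_109 hL) hN hh heven

/-- **PAIR SIEVE `12.19` above `e^190`** (`c = 8`, 68 cells). [cite: BatemanDiamond2004, Thm 13.8, §13.4–13.5 pp. 325–328 (explicit form proved here)] -/
theorem pairCount_le_1219 {N h : ℕ} (hN : Real.exp 190 ≤ (N : ℝ)) (hh : h ≠ 0) (heven : Even h) :
    ((((Nat.primesLE N).filter fun p => (p + h).Prime).card : ℕ) : ℝ)
      ≤ 12.19 * oddSingularFactor h * (N : ℝ) / Real.log (N : ℝ) ^ 2 :=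
  pairCount_le_of_numeric3_c (c := 8) (lc := 2.0796) (by norm_num) (by norm_num)
    (by have := exp_20796_ge; push_cast; linarith) (by norm_num) (by norm_num)
    (fun _ hL => cells8_numeric3_190 hL) hN hh heven

/-! ### §25.4 The RS five-regime glue from `L₁ ≥ 38` -/

set_option maxHeartbeats 4000000 in
/-- **GLUE FOR ALL `y ≥ 1` UNDER (3.3), FIVE REGIMES, `h ≥ 18`, `L₁ ≥ 38`** (ROUND-41 «GAP-16»; as
`half_count_ge_allN_three_RS` with the pair sieves `17.45` from `e^38` (three/four shifts: weights `6·17.45 = 104.7`,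
`14·17.45 = 244.3`), `13.06` from `e^109` (seven shifts: `26.12·421/15 = 274913/375 ≤ 733.11`), `12.19` from `e^190` (twelve
shifts: `24.38·163061/1683 = 198771359/84150 ≤ 2363`), numerals `2^54 ≤ e^38`; prime counts from (3.3)):
`L² + h ≤ h·(6L − 104.7)` on `[L₁, Lt]`, `h·(8L − 244.3)` on `[Lt, L₂]`, `h·(14L − 733.11)` on `[L₂, L₃]` (`L₂ ≥ 109`),
`h·(24L − 2363)` on `[L₃, Λ₀]` (`L₃ ≥ 190`). [cite: RosserSchoenfeld1962, Theorem 2, eq. (3.3) (as input)] -/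

theorem half_count_ge_allN_three_RS38 (hRS : Literature.NumberTheory.LFunctions.RosserSchoenfeld1962_theorem2)
    {L₁ Lt L₂ L₃ Λ₀ : ℝ} {h : ℕ} (h18 : 18 ≤ h) (h40 : 38 ≤ L₁) (hL₁h : L₁ ≤ 2 * h)
    (hL₂ : 109 ≤ L₂) (hL₃ : 190 ≤ L₃) (hΛ4 : Λ₀ ≤ 10000)
    (hquad3 : ∀ L : ℝ, L₁ ≤ L → L ≤ Lt → L ^ 2 + h ≤ h * (6 * L - 104.7))
    (hquad : ∀ L : ℝ, Lt ≤ L → L ≤ L₂ → L ^ 2 + h ≤ h * (8 * L - 244.3))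
    (hquad7 : ∀ L : ℝ, L₂ ≤ L → L ≤ L₃ → L ^ 2 + h ≤ h * (14 * L - 733.11))
    (hquad12 : ∀ L : ℝ, L₃ ≤ L → L ≤ Λ₀ → L ^ 2 + h ≤ h * (24 * L - 2363))
    (hlarge : ∀ x : ℕ, Real.exp Λ₀ ≤ (x : ℝ) →
      (x : ℝ) / (2 * h) ≤ #{N ∈ Ioc 0 x | Even N ∧ ∃ p q : ℕ, p.Prime ∧ q.Prime ∧ p + q = N})
    {y : ℕ} (hy : 1 ≤ y) :
    (y : ℝ) / h ≤ #{b ∈ Ioc 0 y | b ∈ (({0, 1} : Set ℕ) ∪ {m | ∃ p q : ℕ, p.Prime ∧ q.Prime ∧ p + q = 2 * m})} := by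
  set B : Set ℕ := ({0, 1} : Set ℕ) ∪ {m | ∃ p q : ℕ, p.Prime ∧ q.Prime ∧ p + q = 2 * m} with hB
  have hhr : (18 : ℝ) ≤ h := by exact_mod_cast h18
  have hh0 : (0 : ℝ) < h := by linarith
  have hL₁pos : (0 : ℝ) < L₁ := by linarith
  by_cases hbig : Real.exp Λ₀ ≤ ((2 * y : ℕ) : ℝ)
  · have h1 := hlarge (2 * y) hbig
    have h2 := even_goldbach_card_le_half y
    have e : ((2 * y : ℕ) : ℝ) / (2 * h) = (y : ℝ) / h := by
      push_cast
      field_simp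
    rw [e] at h1
    exact h1.trans (by exact_mod_cast h2)
  rw [not_le] at hbig
  by_cases hsmall : y ≤ h
  · have h1 : 1 ≤ #{b ∈ Ioc 0 y | b ∈ B} :=
      card_pos.mpr ⟨1, by
        rw [mem_filter, mem_Ioc]
        exact ⟨⟨by omega, hy⟩, Or.inl (by simp)⟩⟩
    have h1' : (1 : ℝ) ≤ #{b ∈ Ioc 0 y | b ∈ B} := by exact_mod_cast h1
    have h2 : (y : ℝ) / h ≤ 1 := by
      rw [div_le_one hh0]
      exact_mod_cast hsmall
    linarith
  rw [not_le] at hsmall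
  have hy29 : 19 ≤ y := by omega
  have hnr : ((2 * y - 3 : ℕ) : ℝ) = 2 * (y : ℝ) - 3 := cast_two_mul_sub_three (by omega)
  have hy29r : (19 : ℝ) ≤ y := by exact_mod_cast hy29
  have hy0 : (0 : ℝ) < y := by linarith
  have hn55 : 35 ≤ 2 * y - 3 := by omega
  have hn0 : (0 : ℝ) < ((2 * y - 3 : ℕ) : ℝ) := by rw [hnr]; linarith
  have hn1 : (1 : ℝ) < ((2 * y - 3 : ℕ) : ℝ) := by rw [hnr]; linarith
  have hlogpos : 0 < Real.log ((2 * y - 3 : ℕ) : ℝ) := Real.log_pos hn1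
  by_cases hmid : Real.log ((2 * y - 3 : ℕ) : ℝ) ≤ L₁
  · -- ONE SHIFT below `e^{L₁}` (§15, RS)
    have hemb := primeCounting_shift_le_half_count (y := y) (by omega)
    have hembr : (Nat.primeCounting (2 * y - 3) : ℝ) + 1 ≤ #{b ∈ Ioc 0 y | b ∈ B} := by exact_mod_cast hemb
    refine le_trans ?_ hembr
    by_cases h67 : 67 ≤ 2 * y - 3
    · have hπ : 1 * ((2 * y - 3 : ℕ) : ℝ) / Real.log ((2 * y - 3 : ℕ) : ℝ)
          ≤ (Nat.primeCounting (2 * y - 3) : ℝ) := by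
        have := primeCountingLowerMul_one_of_RS hRS
        unfold PrimeCountingLowerMul at this
        exact this (2 * y - 3) h67
      rw [one_mul] at hπ
      have h2 : ((2 * y - 3 : ℕ) : ℝ) / L₁ ≤ ((2 * y - 3 : ℕ) : ℝ) / Real.log ((2 * y - 3 : ℕ) : ℝ) :=
        div_le_div_of_nonneg_left hn0.le hlogpos hmid
      have h3 : (y : ℝ) / h ≤ 2 * y / L₁ := by
        rw [div_le_div_iff₀ hh0 hL₁pos]
        nlinarith [mul_le_mul_of_nonneg_left hL₁h hy0.le]
      have h4 : 2 * (y : ℝ) / L₁ ≤ ((2 * y - 3 : ℕ) : ℝ) / L₁ + 1 := by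
        rw [hnr]
        have e : (2 * (y : ℝ) - 3) / L₁ = 2 * y / L₁ - 3 / L₁ := by
          field_simp
        rw [e]
        have : 3 / L₁ ≤ 1 := by
          rw [div_le_one hL₁pos]
          linarith
        linarith
      linarith [h2, h3, h4, hπ]
    · rw [not_le] at h67
      have hn32 : 32 ≤ 2 * y - 3 := by omega
      have hπ := ShnirelmanGoldbachTheorem.primeCounting_ge hn32
      have hlog7 : Real.log ((2 * y - 3 : ℕ) : ℝ) ≤ 7 := by
        have hy7 : ((2 * y - 3 : ℕ) : ℝ) ≤ (2 : ℝ) ^ 7 := by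
          have : ((2 * y - 3 : ℕ) : ℝ) < 67 := by exact_mod_cast h67
          have h27 : (67 : ℝ) ≤ (2 : ℝ) ^ 7 := by norm_num
          linarith
        have he : (2 : ℝ) ≤ Real.exp 1 := by have := Real.add_one_le_exp (1 : ℝ); linarith
        have h7 : (2 : ℝ) ^ 7 ≤ Real.exp 7 := by
          rw [show (7 : ℝ) = ((7 : ℕ) : ℝ) * 1 by norm_num, Real.exp_nat_mul]
          exact pow_le_pow_left₀ (by norm_num) he 7
        have := Real.log_le_log hn0 (hy7.trans h7)
        rwa [Real.log_exp] at this
      have h5 : ((2 * y - 3 : ℕ) : ℝ) / 28 ≤ ((2 * y - 3 : ℕ) : ℝ) / (4 * Real.log ((2 * y - 3 : ℕ) : ℝ)) :=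
        div_le_div_of_nonneg_left hn0.le (by positivity) (by linarith)
      have h6' : (y : ℝ) / h ≤ (y : ℝ) / 18 := div_le_div_of_nonneg_left hy0.le (by norm_num) hhr
      have h7 : ((2 * y - 3 : ℕ) : ℝ) / 28 + 1 - (y : ℝ) / 18 = (4 * (y : ℝ) + 225) / 252 := by
        rw [hnr]
        ring
      have h8 : 0 ≤ (4 * (y : ℝ) + 225) / 252 := by positivity
      linarith [hπ, h5, h6', h7, h8]
  · -- FOUR SHIFTS on `(e^{L₁}, e^{Λ₀})`, `c₀ = 1`
    rw [not_le] at hmid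
    have h59 : (18014398509481984 : ℝ) < ((2 * y - 3 : ℕ) : ℝ) := by
      have h1 : Real.exp L₁ < ((2 * y - 3 : ℕ) : ℝ) := by
        by_contra hc
        rw [not_lt] at hc
        have := Real.log_le_log hn0 hc
        rw [Real.log_exp] at this
        linarith
      exact lt_of_le_of_lt (numeral_le_exp_38.trans (Real.exp_le_exp.mpr h40)) h1
    have h59n : 18014398509481984 < 2 * y - 3 := by exact_mod_cast h59
    have hy58 : (9007199254740992 : ℝ) ≤ (y : ℝ) := by
      have : 9007199254740992 ≤ y := by omega
      exact_mod_cast this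
    have h2y0 : (0 : ℝ) < ((2 * y : ℕ) : ℝ) := by push_cast; linarith
    set L := Real.log ((2 * y : ℕ) : ℝ) with hLdef
    have hLΛ : L < Λ₀ := by
      have := Real.log_lt_log h2y0 hbig
      rwa [Real.log_exp] at this
    have hL₁L : L₁ ≤ L := by
      have h2y : ((2 * y - 3 : ℕ) : ℝ) ≤ ((2 * y : ℕ) : ℝ) := by rw [hnr]; push_cast; linarith
      exact (hmid.trans_le (Real.log_le_log hn0 h2y)).le
    have hL40 : (38 : ℝ) ≤ L := h40.trans hL₁L
    have hLpos : (0 : ℝ) < L := by linarith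
    have hL4 : L ≤ 10000 := by linarith
    have he40 : Real.exp 38 ≤ ((2 * y : ℕ) : ℝ) := by
      have : Real.exp 38 ≤ Real.exp L := Real.exp_le_exp.mpr hL40
      rwa [hLdef, Real.exp_log h2y0] at this
    have hπ : ∀ q : ℕ, q ≤ 41 → (2 * (y : ℝ) - q) / L ≤ (Nat.primeCounting (2 * y - q) : ℝ) := by
      intro q hq
      have hqr : (q : ℝ) ≤ 41 := by exact_mod_cast hq
      have hnq : ((2 * y - q : ℕ) : ℝ) = 2 * (y : ℝ) - q := cast_two_mul_sub (by omega)
      have h67 : 67 ≤ 2 * y - q := by omega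
      have hnq0 : (0 : ℝ) < ((2 * y - q : ℕ) : ℝ) := by rw [hnq]; linarith
      have hnq1 : (1 : ℝ) < ((2 * y - q : ℕ) : ℝ) := by rw [hnq]; linarith
      have h1 : 1 * ((2 * y - q : ℕ) : ℝ) / Real.log ((2 * y - q : ℕ) : ℝ)
          ≤ (Nat.primeCounting (2 * y - q) : ℝ) := by
        have := primeCountingLowerMul_one_of_RS hRS
        unfold PrimeCountingLowerMul at this
        exact this (2 * y - q) h67
      rw [one_mul] at h1
      have hlogq0 : 0 < Real.log ((2 * y - q : ℕ) : ℝ) := Real.log_pos hnq1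
      have hlogq : Real.log ((2 * y - q : ℕ) : ℝ) ≤ L := by
        have h2y : ((2 * y - q : ℕ) : ℝ) ≤ ((2 * y : ℕ) : ℝ) := by
          rw [hnq]; push_cast; linarith [Nat.cast_nonneg (α := ℝ) q]
        exact Real.log_le_log hnq0 h2y
      have h2 : (2 * (y : ℝ) - q) / L ≤ ((2 * y - q : ℕ) : ℝ) / Real.log ((2 * y - q : ℕ) : ℝ) := by
        rw [← hnq]
        exact div_le_div_of_nonneg_left hnq0.le hlogq0 hlogq
      linarith
    have hP : ∀ d : ℕ, d ≠ 0 → Even d →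
        (#((Nat.primesLE (2 * y)).filter (fun p => (p + d).Prime)) : ℝ)
          ≤ 17.45 * oddSingularFactor d * ((2 * y : ℕ) : ℝ) / L ^ 2 := by
      intro d hd hde
      exact pairCount_le_1745 (N := 2 * y) (h := d) he40 hd hde
    rcases le_or_gt L Lt with hmidt | hmidt
    · -- THREE SHIFTS `{3, 5, 7}` on `(e^{L₁}, e^{Lt}]`
      have hq := hquad3 L hL₁L hmidt
      have hP2 := hP 2 (by norm_num) (by norm_num)
      have hP4 := hP 4 (by norm_num) (by norm_num)
      rw [oddSingularFactor_two'] at hP2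
      rw [oddSingularFactor_four] at hP4
      have hcomb := three_shift_count (y := y) (by omega)
      have hcombr : (Nat.primeCounting (2 * y - 3) : ℝ) + Nat.primeCounting (2 * y - 5)
          + Nat.primeCounting (2 * y - 7)
          ≤ (#{b ∈ Ioc 0 y | b ∈ B} : ℝ) + 2
            + (2 * #((Nat.primesLE (2 * y)).filter (fun p => (p + 2).Prime))
              + #((Nat.primesLE (2 * y)).filter (fun p => (p + 4).Prime))) := by
        exact_mod_cast hcomb
      have hπ3 := hπ 3 (by norm_num)
      have hπ5 := hπ 5 (by norm_num)
      have hπ7 := hπ 7 (by norm_num)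
      push_cast at hπ3 hπ5 hπ7
      have h2yr : ((2 * y : ℕ) : ℝ) = 2 * (y : ℝ) := by push_cast; ring
      rw [h2yr] at hP2 hP4
      set G : ℝ := (#{b ∈ Ioc 0 y | b ∈ B} : ℝ) with hG
      set Y : ℝ := (y : ℝ) with hY
      have hG1 : (6 * Y - 15) / L - 2 - 104.7 * Y / L ^ 2 ≤ G := by
        have e1 : (6 * Y - 15) / L = (2 * Y - 3) / L + (2 * Y - 5) / L + (2 * Y - 7) / L := by
          field_simp
          ring
        have e2 : 104.7 * Y / L ^ 2 = 2 * (17.45 * 1 * (2 * Y) / L ^ 2) + 17.45 * 1 * (2 * Y) / L ^ 2 := by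
          field_simp
          ring
        rw [e1, e2]
        linarith [hcombr, hπ3, hπ5, hπ7, hP2, hP4]
      have hL2 : (0 : ℝ) < L ^ 2 := by positivity
      have hkey : Y * L ^ 2 ≤ (h : ℝ) * G * L ^ 2 := by
        have e3 : ((6 * Y - 15) / L - 2 - 104.7 * Y / L ^ 2) * L ^ 2
            = 6 * Y * L - 15 * L - 2 * L ^ 2 - 104.7 * Y := by
          field_simp
        have h1 : (6 * Y * L - 15 * L - 2 * L ^ 2 - 104.7 * Y) * h ≤ G * L ^ 2 * h := by
          rw [← e3]
          exact mul_le_mul_of_nonneg_right (mul_le_mul_of_nonneg_right hG1 hL2.le) hh0.le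
        have h2 : Y * (L ^ 2 + h) ≤ Y * (h * (6 * L - 104.7)) :=
          mul_le_mul_of_nonneg_left hq (by linarith)
        have h3 : 15 * L + 2 * L ^ 2 ≤ Y := by
          nlinarith [mul_nonneg (sub_nonneg.2 hL4) hLpos.le]
        have h3' : (h : ℝ) * (15 * L + 2 * L ^ 2) ≤ h * Y := mul_le_mul_of_nonneg_left h3 hh0.le
        nlinarith [h1, h2, h3']
      have hfin := le_of_mul_le_mul_right hkey hL2
      rw [div_le_iff₀ hh0, mul_comm]
      exact hfin
    · rcases le_or_gt L L₂ with hmid2 | hmid2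
      · -- FOUR SHIFTS on `(e^{Lt}, e^{L₂}]`
        have hq := hquad L hmidt.le hmid2
        have hP2 := hP 2 (by norm_num) (by norm_num)
        have hP4 := hP 4 (by norm_num) (by norm_num)
        have hP6 := hP 6 (by norm_num) (by norm_num)
        have hP8 := hP 8 (by norm_num) (by norm_num)
        rw [oddSingularFactor_two'] at hP2
        rw [oddSingularFactor_four] at hP4
        rw [oddSingularFactor_six] at hP6
        rw [oddSingularFactor_eight] at hP8
        have hcomb := four_shift_count (y := y) (by omega)
        have hcombr : (Nat.primeCounting (2 * y - 3) : ℝ) + Nat.primeCounting (2 * y - 5)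
            + Nat.primeCounting (2 * y - 7) + Nat.primeCounting (2 * y - 11)
            ≤ (#{b ∈ Ioc 0 y | b ∈ B} : ℝ) + 2
              + (2 * #((Nat.primesLE (2 * y)).filter (fun p => (p + 2).Prime))
                + 2 * #((Nat.primesLE (2 * y)).filter (fun p => (p + 4).Prime))
                + #((Nat.primesLE (2 * y)).filter (fun p => (p + 8).Prime))
                + #((Nat.primesLE (2 * y)).filter (fun p => (p + 6).Prime))) := by
          exact_mod_cast hcomb
        have hπ3 := hπ 3 (by norm_num)
        have hπ5 := hπ 5 (by norm_num)
        have hπ7 := hπ 7 (by norm_num)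
        have hπ11 := hπ 11 (by norm_num)
        push_cast at hπ3 hπ5 hπ7 hπ11
        have h2yr : ((2 * y : ℕ) : ℝ) = 2 * (y : ℝ) := by push_cast; ring
        rw [h2yr] at hP2 hP4 hP6 hP8
        set G : ℝ := (#{b ∈ Ioc 0 y | b ∈ B} : ℝ) with hG
        set Y : ℝ := (y : ℝ) with hY
        have hG1 : (8 * Y - 26) / L - 2 - 244.3 * Y / L ^ 2 ≤ G := by
          have e1 : (8 * Y - 26) / L = (2 * Y - 3) / L + (2 * Y - 5) / L + (2 * Y - 7) / L + (2 * Y - 11) / L := by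
            field_simp
            ring
          have e2 : 244.3 * Y / L ^ 2 = 2 * (17.45 * 1 * (2 * Y) / L ^ 2) + 2 * (17.45 * 1 * (2 * Y) / L ^ 2)
              + 17.45 * 1 * (2 * Y) / L ^ 2 + 17.45 * 2 * (2 * Y) / L ^ 2 := by
            field_simp
            ring
          rw [e1, e2]
          linarith [hcombr, hπ3, hπ5, hπ7, hπ11, hP2, hP4, hP6, hP8]
        have hL2 : (0 : ℝ) < L ^ 2 := by positivity
        have hkey : Y * L ^ 2 ≤ (h : ℝ) * G * L ^ 2 := by
          have e3 : ((8 * Y - 26) / L - 2 - 244.3 * Y / L ^ 2) * L ^ 2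
              = 8 * Y * L - 26 * L - 2 * L ^ 2 - 244.3 * Y := by
            field_simp
          have h1 : (8 * Y * L - 26 * L - 2 * L ^ 2 - 244.3 * Y) * h ≤ G * L ^ 2 * h := by
            rw [← e3]
            exact mul_le_mul_of_nonneg_right (mul_le_mul_of_nonneg_right hG1 hL2.le) hh0.le
          have h2 : Y * (L ^ 2 + h) ≤ Y * (h * (8 * L - 244.3)) :=
            mul_le_mul_of_nonneg_left hq (by linarith)
          have h3 : 26 * L + 2 * L ^ 2 ≤ Y := by
            nlinarith [mul_nonneg (sub_nonneg.2 hL4) hLpos.le]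
          have h3' : (h : ℝ) * (26 * L + 2 * L ^ 2) ≤ h * Y := mul_le_mul_of_nonneg_left h3 hh0.le
          nlinarith [h1, h2, h3']
        have hfin := le_of_mul_le_mul_right hkey hL2
        rw [div_le_iff₀ hh0, mul_comm]
        exact hfin
      · rcases le_or_gt L L₃ with hmid3 | hmid3
        · -- SEVEN SHIFTS on `(e^{L₂}, e^{L₃}]`
          have hq := hquad7 L hmid2.le hmid3
          have he118 : Real.exp 109 ≤ ((2 * y : ℕ) : ℝ) := by
            have : Real.exp 109 ≤ Real.exp L := Real.exp_le_exp.mpr (hL₂.trans hmid2.le)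
            rwa [hLdef, Real.exp_log h2y0] at this
          have hP7 : ∀ d : ℕ, d ≠ 0 → Even d →
              (#((Nat.primesLE (2 * y)).filter (fun p => (p + d).Prime)) : ℝ)
                ≤ 13.06 * oddSingularFactor d * ((2 * y : ℕ) : ℝ) / L ^ 2 := by
            intro d hd hde
            rw [hLdef]
            exact pairCount_le_1306 (N := 2 * y) (h := d) he118 hd hde
          have hP2 := hP7 2 (by norm_num) (by norm_num)
          have hP4 := hP7 4 (by norm_num) (by norm_num)
          have hP6 := hP7 6 (by norm_num) (by norm_num)
          have hP8 := hP7 8 (by norm_num) (by norm_num)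
          have hP10 := hP7 10 (by norm_num) (by norm_num)
          have hP12 := hP7 12 (by norm_num) (by norm_num)
          have hP14 := hP7 14 (by norm_num) (by norm_num)
          have hP16 := hP7 16 (by norm_num) (by norm_num)
          rw [oddSingularFactor_two'] at hP2
          rw [oddSingularFactor_four] at hP4
          rw [oddSingularFactor_six] at hP6
          rw [oddSingularFactor_eight] at hP8
          rw [oddSingularFactor_ten] at hP10
          rw [oddSingularFactor_twelve] at hP12
          rw [oddSingularFactor_fourteen] at hP14
          rw [oddSingularFactor_sixteen] at hP16
          have hcomb := seven_shift_count (y := y) (by omega)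
          have hcombr : (Nat.primeCounting (2 * y - 3) : ℝ) + Nat.primeCounting (2 * y - 5)
              + Nat.primeCounting (2 * y - 7) + Nat.primeCounting (2 * y - 11) + Nat.primeCounting (2 * y - 13)
              + Nat.primeCounting (2 * y - 17) + Nat.primeCounting (2 * y - 19)
              ≤ (#{b ∈ Ioc 0 y | b ∈ B} : ℝ) + 5
                + (4 * #((Nat.primesLE (2 * y)).filter (fun p => (p + 2).Prime))
                  + 3 * #((Nat.primesLE (2 * y)).filter (fun p => (p + 4).Prime))
                  + 4 * #((Nat.primesLE (2 * y)).filter (fun p => (p + 6).Prime))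
                  + 3 * #((Nat.primesLE (2 * y)).filter (fun p => (p + 8).Prime))
                  + 2 * #((Nat.primesLE (2 * y)).filter (fun p => (p + 10).Prime))
                  + 2 * #((Nat.primesLE (2 * y)).filter (fun p => (p + 12).Prime))
                  + 2 * #((Nat.primesLE (2 * y)).filter (fun p => (p + 14).Prime))
                  + #((Nat.primesLE (2 * y)).filter (fun p => (p + 16).Prime))) := by
            exact_mod_cast hcomb
          have hπ3 := hπ 3 (by norm_num)
          have hπ5 := hπ 5 (by norm_num)
          have hπ7 := hπ 7 (by norm_num)
          have hπ11 := hπ 11 (by norm_num)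
          have hπ13 := hπ 13 (by norm_num)
          have hπ17 := hπ 17 (by norm_num)
          have hπ19 := hπ 19 (by norm_num)
          push_cast at hπ3 hπ5 hπ7 hπ11 hπ13 hπ17 hπ19
          have h2yr : ((2 * y : ℕ) : ℝ) = 2 * (y : ℝ) := by push_cast; ring
          rw [h2yr] at hP2 hP4 hP6 hP8 hP10 hP12 hP14 hP16
          set G : ℝ := (#{b ∈ Ioc 0 y | b ∈ B} : ℝ) with hG
          set Y : ℝ := (y : ℝ) with hY
          have hY0 : 0 ≤ Y := le_trans (by norm_num) hy58
          have hL2 : (0 : ℝ) < L ^ 2 := by positivity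
          have hG1 : (14 * Y - 75) / L - 5 - 733.11 * Y / L ^ 2 ≤ G := by
            have e1 : (14 * Y - 75) / L
                = (2 * Y - 3) / L + (2 * Y - 5) / L + (2 * Y - 7) / L + (2 * Y - 11) / L + (2 * Y - 13) / L + (2 * Y - 17) / L + (2 * Y - 19) / L := by
              field_simp
              ring
            have e2 : 4 * (13.06 * 1 * (2 * Y) / L ^ 2) + 3 * (13.06 * 1 * (2 * Y) / L ^ 2)
                + 4 * (13.06 * 2 * (2 * Y) / L ^ 2) + 3 * (13.06 * 1 * (2 * Y) / L ^ 2)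
                + 2 * (13.06 * (4 / 3) * (2 * Y) / L ^ 2) + 2 * (13.06 * 2 * (2 * Y) / L ^ 2)
                + 2 * (13.06 * (6 / 5) * (2 * Y) / L ^ 2) + 13.06 * 1 * (2 * Y) / L ^ 2
                = (274913 / 375) * Y / L ^ 2 := by
              field_simp
              ring
            have e3 : (274913 / 375 : ℝ) * Y / L ^ 2 ≤ 733.11 * Y / L ^ 2 :=
              div_le_div_of_nonneg_right (mul_le_mul_of_nonneg_right (by norm_num) hY0) hL2.le
            rw [e1]
            linarith [hcombr, hπ3, hπ5, hπ7, hπ11, hπ13, hπ17, hπ19, hP2, hP4, hP6, hP8, hP10, hP12, hP14, hP16,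
              e2, e3]
          have hkey : Y * L ^ 2 ≤ (h : ℝ) * G * L ^ 2 := by
            have e4 : ((14 * Y - 75) / L - 5 - 733.11 * Y / L ^ 2) * L ^ 2
                = 14 * Y * L - 75 * L - 5 * L ^ 2 - 733.11 * Y := by
              field_simp
            have h1 : (14 * Y * L - 75 * L - 5 * L ^ 2 - 733.11 * Y) * h ≤ G * L ^ 2 * h := by
              rw [← e4]
              exact mul_le_mul_of_nonneg_right (mul_le_mul_of_nonneg_right hG1 hL2.le) hh0.le
            have h2 : Y * (L ^ 2 + h) ≤ Y * (h * (14 * L - 733.11)) :=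
              mul_le_mul_of_nonneg_left hq (by linarith)
            have h3 : 75 * L + 5 * L ^ 2 ≤ Y := by
              nlinarith [mul_nonneg (sub_nonneg.2 hL4) hLpos.le]
            have h3' : (h : ℝ) * (75 * L + 5 * L ^ 2) ≤ h * Y := mul_le_mul_of_nonneg_left h3 hh0.le
            nlinarith [h1, h2, h3']
          have hfin := le_of_mul_le_mul_right hkey hL2
          rw [div_le_iff₀ hh0, mul_comm]
          exact hfin
        · -- TWELVE SHIFTS on `(e^{L₃}, e^{Λ₀})`, pair sieve at the threshold `e^215`
          have hq := hquad12 L hmid3.le hLΛ.le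
          have he207 : Real.exp 190 ≤ ((2 * y : ℕ) : ℝ) := by
            have : Real.exp 190 ≤ Real.exp L := Real.exp_le_exp.mpr (hL₃.trans hmid3.le)
            rwa [hLdef, Real.exp_log h2y0] at this
          have hPt : ∀ d : ℕ, d ≠ 0 → Even d →
              (#((Nat.primesLE (2 * y)).filter (fun p => (p + d).Prime)) : ℝ)
                ≤ 12.19 * oddSingularFactor d * ((2 * y : ℕ) : ℝ) / L ^ 2 := by
            intro d hd hde
            rw [hLdef]
            exact pairCount_le_1219 (N := 2 * y) (h := d) he207 hd hde
          have hQ2 := hPt 2 (by norm_num) (by norm_num)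
          have hQ4 := hPt 4 (by norm_num) (by norm_num)
          have hQ6 := hPt 6 (by norm_num) (by norm_num)
          have hQ8 := hPt 8 (by norm_num) (by norm_num)
          have hQ10 := hPt 10 (by norm_num) (by norm_num)
          have hQ12 := hPt 12 (by norm_num) (by norm_num)
          have hQ14 := hPt 14 (by norm_num) (by norm_num)
          have hQ16 := hPt 16 (by norm_num) (by norm_num)
          have hQ18 := hPt 18 (by norm_num) (by norm_num)
          have hQ20 := hPt 20 (by norm_num) (by norm_num)
          have hQ22 := hPt 22 (by norm_num) (by norm_num)
          have hQ24 := hPt 24 (by norm_num) (by norm_num)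
          have hQ26 := hPt 26 (by norm_num) (by norm_num)
          have hQ28 := hPt 28 (by norm_num) (by norm_num)
          have hQ30 := hPt 30 (by norm_num) (by norm_num)
          have hQ32 := hPt 32 (by norm_num) (by norm_num)
          have hQ34 := hPt 34 (by norm_num) (by norm_num)
          have hQ36 := hPt 36 (by norm_num) (by norm_num)
          have hQ38 := hPt 38 (by norm_num) (by norm_num)
          rw [oddSingularFactor_two'] at hQ2
          rw [oddSingularFactor_four] at hQ4
          rw [oddSingularFactor_six] at hQ6
          rw [oddSingularFactor_eight] at hQ8
          rw [oddSingularFactor_ten] at hQ10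
          rw [oddSingularFactor_twelve] at hQ12
          rw [oddSingularFactor_fourteen] at hQ14
          rw [oddSingularFactor_sixteen] at hQ16
          rw [oddSingularFactor_eighteen] at hQ18
          rw [oddSingularFactor_twenty] at hQ20
          rw [oddSingularFactor_twentytwo] at hQ22
          rw [oddSingularFactor_twentyfour] at hQ24
          rw [oddSingularFactor_twentysix] at hQ26
          rw [oddSingularFactor_twentyeight] at hQ28
          rw [oddSingularFactor_thirty] at hQ30
          rw [oddSingularFactor_thirtytwo] at hQ32
          rw [oddSingularFactor_thirtyfour] at hQ34
          rw [oddSingularFactor_thirtysix] at hQ36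
          rw [oddSingularFactor_thirtyeight] at hQ38
          have hcomb := twelve_shift_count (y := y) (by omega)
          have hcombr : (Nat.primeCounting (2 * y - 3) : ℝ) + Nat.primeCounting (2 * y - 5)
              + Nat.primeCounting (2 * y - 7) + Nat.primeCounting (2 * y - 11) + Nat.primeCounting (2 * y - 13)
              + Nat.primeCounting (2 * y - 17) + Nat.primeCounting (2 * y - 19) + Nat.primeCounting (2 * y - 23)
              + Nat.primeCounting (2 * y - 29) + Nat.primeCounting (2 * y - 31) + Nat.primeCounting (2 * y - 37)
              + Nat.primeCounting (2 * y - 41)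
              ≤ (#{b ∈ Ioc 0 y | b ∈ (({0, 1} : Set ℕ) ∪ {m | ∃ p q : ℕ, p.Prime ∧ q.Prime ∧ p + q = 2 * m})} : ℝ) + 10
                + (5 * #((Nat.primesLE (2 * y)).filter (fun p => (p + 2).Prime))
                  + 5 * #((Nat.primesLE (2 * y)).filter (fun p => (p + 4).Prime))
                  + 7 * #((Nat.primesLE (2 * y)).filter (fun p => (p + 6).Prime))
                  + 5 * #((Nat.primesLE (2 * y)).filter (fun p => (p + 8).Prime))
                  + 5 * #((Nat.primesLE (2 * y)).filter (fun p => (p + 10).Prime))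
                  + 6 * #((Nat.primesLE (2 * y)).filter (fun p => (p + 12).Prime))
                  + 4 * #((Nat.primesLE (2 * y)).filter (fun p => (p + 14).Prime))
                  + 3 * #((Nat.primesLE (2 * y)).filter (fun p => (p + 16).Prime))
                  + 5 * #((Nat.primesLE (2 * y)).filter (fun p => (p + 18).Prime))
                  + 3 * #((Nat.primesLE (2 * y)).filter (fun p => (p + 20).Prime))
                  + 2 * #((Nat.primesLE (2 * y)).filter (fun p => (p + 22).Prime))
                  + 4 * #((Nat.primesLE (2 * y)).filter (fun p => (p + 24).Prime))
                  + 3 * #((Nat.primesLE (2 * y)).filter (fun p => (p + 26).Prime))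
                  + 2 * #((Nat.primesLE (2 * y)).filter (fun p => (p + 28).Prime))
                  + 2 * #((Nat.primesLE (2 * y)).filter (fun p => (p + 30).Prime))
                  + #((Nat.primesLE (2 * y)).filter (fun p => (p + 32).Prime))
                  + 2 * #((Nat.primesLE (2 * y)).filter (fun p => (p + 34).Prime))
                  + #((Nat.primesLE (2 * y)).filter (fun p => (p + 36).Prime))
                  + #((Nat.primesLE (2 * y)).filter (fun p => (p + 38).Prime))) := by
            exact_mod_cast hcomb
          have hπ3 := hπ 3 (by norm_num)
          have hπ5 := hπ 5 (by norm_num)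
          have hπ7 := hπ 7 (by norm_num)
          have hπ11 := hπ 11 (by norm_num)
          have hπ13 := hπ 13 (by norm_num)
          have hπ17 := hπ 17 (by norm_num)
          have hπ19 := hπ 19 (by norm_num)
          have hπ23 := hπ 23 (by norm_num)
          have hπ29 := hπ 29 (by norm_num)
          have hπ31 := hπ 31 (by norm_num)
          have hπ37 := hπ 37 (by norm_num)
          have hπ41 := hπ 41 (by norm_num)
          push_cast at hπ3 hπ5 hπ7 hπ11 hπ13 hπ17 hπ19 hπ23 hπ29 hπ31 hπ37 hπ41
          have h2yr : ((2 * y : ℕ) : ℝ) = 2 * (y : ℝ) := by push_cast; ring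
          rw [h2yr] at hQ2 hQ4 hQ6 hQ8 hQ10 hQ12 hQ14 hQ16 hQ18 hQ20 hQ22 hQ24 hQ26 hQ28 hQ30 hQ32 hQ34 hQ36 hQ38
          set G : ℝ := (#{b ∈ Ioc 0 y | b ∈ (({0, 1} : Set ℕ) ∪ {m | ∃ p q : ℕ, p.Prime ∧ q.Prime ∧ p + q = 2 * m})} : ℝ) with hG
          set Y : ℝ := (y : ℝ) with hY
          have hY0 : 0 ≤ Y := le_trans (by norm_num) hy58
          have hL2 : (0 : ℝ) < L ^ 2 := by positivity
          have hG1 : (24 * Y - 236) / L - 10 - 2363 * Y / L ^ 2 ≤ G := by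
            have e1 : (24 * Y - 236) / L
                = (2 * Y - 3) / L + (2 * Y - 5) / L + (2 * Y - 7) / L + (2 * Y - 11) / L
                  + (2 * Y - 13) / L + (2 * Y - 17) / L + (2 * Y - 19) / L + (2 * Y - 23) / L
                  + (2 * Y - 29) / L + (2 * Y - 31) / L + (2 * Y - 37) / L + (2 * Y - 41) / L := by
              field_simp
              ring
            have e2 : 5 * (12.19 * 1 * (2 * Y) / L ^ 2)
                + 5 * (12.19 * 1 * (2 * Y) / L ^ 2)
                + 7 * (12.19 * 2 * (2 * Y) / L ^ 2)
                + 5 * (12.19 * 1 * (2 * Y) / L ^ 2)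
                + 5 * (12.19 * (4 / 3) * (2 * Y) / L ^ 2)
                + 6 * (12.19 * 2 * (2 * Y) / L ^ 2)
                + 4 * (12.19 * (6 / 5) * (2 * Y) / L ^ 2)
                + 3 * (12.19 * 1 * (2 * Y) / L ^ 2)
                + 5 * (12.19 * 2 * (2 * Y) / L ^ 2)
                + 3 * (12.19 * (4 / 3) * (2 * Y) / L ^ 2)
                + 2 * (12.19 * (10 / 9) * (2 * Y) / L ^ 2)
                + 4 * (12.19 * 2 * (2 * Y) / L ^ 2)
                + 3 * (12.19 * (12 / 11) * (2 * Y) / L ^ 2)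
                + 2 * (12.19 * (6 / 5) * (2 * Y) / L ^ 2)
                + 2 * (12.19 * (8 / 3) * (2 * Y) / L ^ 2)
                + 12.19 * 1 * (2 * Y) / L ^ 2
                + 2 * (12.19 * (16 / 15) * (2 * Y) / L ^ 2)
                + 12.19 * 2 * (2 * Y) / L ^ 2
                + 12.19 * (18 / 17) * (2 * Y) / L ^ 2
                = (198771359 / 84150) * Y / L ^ 2 := by
              field_simp
              ring
            have e3 : (198771359 / 84150 : ℝ) * Y / L ^ 2 ≤ 2363 * Y / L ^ 2 :=
              div_le_div_of_nonneg_right (mul_le_mul_of_nonneg_right (by norm_num) hY0) hL2.le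
            rw [e1]
            linarith [hcombr, hπ3, hπ5, hπ7, hπ11, hπ13, hπ17, hπ19, hπ23, hπ29, hπ31, hπ37, hπ41,
              hQ2, hQ4, hQ6, hQ8, hQ10, hQ12, hQ14, hQ16, hQ18, hQ20, hQ22, hQ24, hQ26, hQ28, hQ30, hQ32, hQ34, hQ36, hQ38, e2, e3]
          have hkey : Y * L ^ 2 ≤ (h : ℝ) * G * L ^ 2 := by
            have e4 : ((24 * Y - 236) / L - 10 - 2363 * Y / L ^ 2) * L ^ 2
                = 24 * Y * L - 236 * L - 10 * L ^ 2 - 2363 * Y := by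
              field_simp
            have h1 : (24 * Y * L - 236 * L - 10 * L ^ 2 - 2363 * Y) * h ≤ G * L ^ 2 * h := by
              rw [← e4]
              exact mul_le_mul_of_nonneg_right (mul_le_mul_of_nonneg_right hG1 hL2.le) hh0.le
            have h2 : Y * (L ^ 2 + h) ≤ Y * (h * (24 * L - 2363)) :=
              mul_le_mul_of_nonneg_left hq (by linarith)
            have h3 : 236 * L + 10 * L ^ 2 ≤ Y := by
              nlinarith [mul_nonneg (sub_nonneg.2 hL4) hLpos.le]
            have h3' : (h : ℝ) * (236 * L + 10 * L ^ 2) ≤ h * Y := mul_le_mul_of_nonneg_left h3 hh0.le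
            nlinarith [h1, h2, h3']
          have hfin := le_of_mul_le_mul_right hkey hL2
          rw [div_le_iff₀ hh0, mul_comm]
          exact hfin


/-! ### §25.5 The count `11.78` from `e^294`, the RS instance `h = 19`, `K = 39` -/

/-- `c = 16` numerics at `Λ = 294` on `TlowK3`: `257L² ≤ 256·11.76·TlowK3(L/2 − 2.7728)` for `L ≥ 294`. [folklore] -/
private theorem cells16_numeric3_294 {L : ℝ} (hL : 294 ≤ L) :
    (((16 : ℕ) : ℝ) ^ 2 + 1) * L ^ 2 ≤ ((16 : ℕ) : ℝ) ^ 2 * (11.78 - 0.02) * TlowK3 (L / 2 - 2.7728) := by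
  unfold TlowK3
  push_cast
  nlinarith [hL, mul_self_nonneg (L - 294)]

/-- **GOLDBACH SIEVE `11.78` above `e^294`** (`c = 16`, the 68 cells). [cite: BatemanDiamond2004, §13.4 (13.13)–(13.14)] -/
theorem goldbachCount_le_1178 {N : ℕ} (hN : Real.exp 294 ≤ (N : ℝ)) (heven : Even N) :
    (SingularSeries.goldbachCount N : ℝ) ≤ 11.78 * oddSingularFactor N * (N : ℝ) / Real.log (N : ℝ) ^ 2 :=
  goldbachCount_le_of_numeric3_c (c := 16) (lc := 2.7728) (by norm_num) (by norm_num)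
    (by have := exp_27728_ge; push_cast; linarith) (by norm_num) (by norm_num)
    (fun _ hL => cells16_numeric3_294 hL) hN heven

/-- **Under (3.3), above `e^310`**: at least `x/38` even Goldbach numbers in `(0, x]` (`J = 400` levels, gap `16`: `Λs = 294`,
`A = 11.78`, `c₁ = 0.4995`; `(1/38)⁷·259.55·11.78⁸ = 0.8412 ≤ (0.4994·gHol4 310 − 0.00005)⁸ = 0.8579`).
[cite: RosserSchoenfeld1962, Theorem 2, eq. (3.3) (as input)] -/
theorem goldbach_even_count_ge_of_RS_38 (hRS : Literature.NumberTheory.LFunctions.RosserSchoenfeld1962_theorem2)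
    {x : ℕ} (hx : Real.exp 310 ≤ (x : ℝ)) :
    (x : ℝ) / 38 ≤ #{N ∈ Ioc 0 x | Even N ∧ ∃ p q : ℕ, p.Prime ∧ q.Prime ∧ p + q = N} := by
  have h := goldbach_even_count_ge_holder400g (Λs := 294) (Λ₀ := 310) (A := 11.78) (c₁ := 0.4995) (κ := 1 / 38)
    (by norm_num) (by norm_num) (by norm_num) (by norm_num) (by norm_num)
    (fun N hN hev => goldbachCount_le_1178 hN hev) (by norm_num) (by norm_num)
    (fun y hy => sum_goldbachCount_ge_of_RS' hRS ((Real.exp_le_exp.mpr (by norm_num)).trans hy))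
    (by unfold gHol4; norm_num) (by unfold gHol4; norm_num) hx
  have e : (1 : ℝ) / 38 * x = x / 38 := by ring
  rw [e] at h
  exact h

/-- **Count for all `y ≥ 1` under (3.3)**: `B(y) ≥ y/19` (`L₁ = 38 = 2·19`, three shifts on `[38, 92]`, four on `[92, 109]`,
seven on `[109, 192]`, twelve on `[192, 310]`, count above `e^310`; windows `[21.8, 92.2]`, `[42.7, 109.3]`, `[71.9, 194.1]`,
`[144.0, 312.0]`). [cite: RosserSchoenfeld1962, Theorem 2, eq. (3.3) (as input)] -/
theorem half_count_ge_allN_of_RS_19 (hRS : Literature.NumberTheory.LFunctions.RosserSchoenfeld1962_theorem2)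
    {y : ℕ} (hy : 1 ≤ y) :
    (y : ℝ) / 19 ≤ #{b ∈ Ioc 0 y | b ∈ (({0, 1} : Set ℕ) ∪ {m | ∃ p q : ℕ, p.Prime ∧ q.Prime ∧ p + q = 2 * m})} := by
  have h := half_count_ge_allN_three_RS38 hRS (L₁ := 38) (Lt := 92) (L₂ := 109) (L₃ := 192) (Λ₀ := 310) (h := 19)
    (by norm_num) (by norm_num) (by norm_num) (by norm_num) (by norm_num) (by norm_num)
    (fun L h1 h2 => by
      push_cast
      nlinarith [mul_nonneg (sub_nonneg.2 h1) (sub_nonneg.2 h2)])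
    (fun L h1 h2 => by
      push_cast
      nlinarith [mul_nonneg (sub_nonneg.2 h1) (sub_nonneg.2 h2)])
    (fun L h1 h2 => by
      push_cast
      nlinarith [mul_nonneg (sub_nonneg.2 h1) (sub_nonneg.2 h2)])
    (fun L h1 h2 => by
      push_cast
      nlinarith [mul_nonneg (sub_nonneg.2 h1) (sub_nonneg.2 h2)])
    (fun x hx => by
      have h1 := goldbach_even_count_ge_of_RS_38 hRS hx
      have e : (x : ℝ) / (2 * ((19 : ℕ) : ℝ)) = (x : ℝ) / 38 := by norm_num
      rw [e]
      exact h1) hy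
  exact_mod_cast h

/-- **The halved density under (3.3), `1/19`**. [cite: RosserSchoenfeld1962, Theorem 2, eq. (3.3) (as input)] -/
theorem schnirelmannDensity_half_ge_of_RS_19 (hRS : Literature.NumberTheory.LFunctions.RosserSchoenfeld1962_theorem2) :
    (1 : ℝ) / 19 ≤ schnirelmannDensity
      (({0, 1} : Set ℕ) ∪ {m | ∃ p q : ℕ, p.Prime ∧ q.Prime ∧ p + q = 2 * m}) := by
  have h := schnirelmannDensity_ge_of_count' (K := 19)
    (S := ({0, 1} : Set ℕ) ∪ {m | ∃ p q : ℕ, p.Prime ∧ q.Prime ∧ p + q = 2 * m})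
    (fun N hN => by have := half_count_ge_allN_of_RS_19 hRS hN; exact_mod_cast this)
  exact_mod_cast h

/-- ★★★★★★★★★★★★★★★★★ **Under Rosser–Schoenfeld (3.3): every integer `N ≥ 2` is a sum of at most `39` primes**
(ROUND-41 «GAP-16»: the `J = 400` Hölder count with threshold gap `16` (`F = 0.4994·gHol4(Λ₀) − 0.00005`), the count
`x/38` above `e^310` (`A = 11.78` at `e^294` on the 68 cells), the pair sieve re-run from `e^38` (`17.45`), `e^109` (`13.06`)
and `e^190` (`12.19`) so that the five RS regimes serve `h = 19` from `L₁ = 38`; Mann `2·19 + 1`).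
[cite: RosserSchoenfeld1962, Theorem 2, eq. (3.3) (as input); Nathanson1996, Thm 7.9] -/
theorem schnirelmann_goldbach_of_RS_le_39 (hRS : Literature.NumberTheory.LFunctions.RosserSchoenfeld1962_theorem2)
    (N : ℕ) (hN : 2 ≤ N) :
    ∃ M : Multiset ℕ, (∀ p ∈ M, p.Prime) ∧ Multiset.card M ≤ 39 ∧ M.sum = N := by
  have hσ : (1 : ℝ) / ((19 : ℕ) : ℝ) ≤ schnirelmannDensity
      (({0, 1} : Set ℕ) ∪ {m | ∃ p q : ℕ, p.Prime ∧ q.Prime ∧ p + q = 2 * m}) := by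
    have := schnirelmannDensity_half_ge_of_RS_19 hRS
    exact_mod_cast this
  exact sum_of_primes_of_half_density_mann (h := 19) (by norm_num) hσ N hN

end Literature.NumberTheory.Sieve.ShnirelmanGoldbachExplicit
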